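import Summits.KontsevichZagierPeriods.KontsevichZagierPeriods.Theses.FurushoPentagon
import Summits.KontsevichZagierPeriods.KontsevichZagierPeriods.Theorems.FurushoPentagonPentagonInKZPathFamilies
import Summits.KontsevichZagierPeriods.KontsevichZagierPeriods.Theorems.FurushoPentagonPentagonInKZGroupLike
import Literature.NumberTheory.Transcendental.DrinfeldAssociatorRegularisation
import Literature.NumberTheory.Transcendental.AssociatorsHexagonProofs
import Literature.NumberTheory.Transcendental.DrinfeldAssociatorProofs
import Literature.NumberTheory.Transcendental.AssociatorsProofs
import Literature.NumberTheory.Transcendental.AssociatorsEval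
import Literature.NumberTheory.Transcendental.KZLogCalculusProofs

/-!
# `PentagonInKZ` (stmt-KontsevichZagierPeriods-11348) — line `edge-normal-newton-leibniz`: skeleton (second lead)

Crux `Summit.KontsevichZagierPeriods.KontsevichZagierPeriods.Theses.FurushoPentagon.PentagonInKZ`
(realisation form of Drinfeld's pentagon for the rules associator).  SECOND LEAD's skeleton of the
line `edge-normal-newton-leibniz` (unit `line-stmt-KontsevichZagierPeriods-11348-b`).

## Architecture

The (E) half-edge and (T) telescoping layers are SHARED VERBATIM with the first lead's line
`logfree-gauge-corner-flatness` (`Cruxes/PentagonInKZ/Lines/logfree-gauge-corner-flatness.lean`):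
the fifteen-path atlas, the log-free transports `P p`, the stubs `stub_pathFamilies`, `stub_groupLike`
(LANDED, imported), `stub_shuffleProduct`, `stub_halfEdgeUniversal`, `stub_chartB` (identical
signatures: whichever team lands them, both skeletons close) and the sorry-free composition
`PentagonInKZ_of` (Drinfeld's telescoping in the group of units of `U𝔞₄ ⊗ R/(deg>N)`).

What this line OWNS is the two-dimensional content, the five log-free corner identities
`M0M5 = M4M6`, `M0M7 = M1M8`, `M2M10 = M1M9`, `M2M11 = M3M12`, `M4M14 = M3M13` — the first lead's single
XL stub `stub_logfreeCorners` — which here is a THEOREM (`logfreeCorners`) derived from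

* `stub_cornerPrinciple` [XL, held by the lead]: the general LOG-FREE CORNER PRINCIPLE.  Data: a
  product chart `[0,α] × [0,β]` (`α, β ∈ ℚ_{>0}`), finitely many BILINEAR divisors
  `φ_k(ξ,η) = a_k + b_k ξ + c_k η + d_k ξη` (`k : Fin (m+2)`, `φ₀ = ξ`, `φ₁ = η`, the others
  non-vanishing on the closed rectangle), residues `Z_k = Σ n_k(i,j) t_ij ∈ U𝔞₄` (integer
  combinations), the connection `Ω = Σ_k Z_k dlog φ_k = f dξ + g dη`; hypotheses: pointwise flatness
  `[f, g] = 0` on the open rectangle (`dΩ = 0` is automatic), the two EDGE CENTRALITIES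
  `[Z₀, g(0,η)] = 0`, `[Z₁, f(ξ,0)] = 0` and `[Z₀, Z₁] = 0` (all in `U𝔞₄ ⊗ ℝ/(deg>N)`); objects: the four
  families of absolutely convergent rational iterated integrals along the four sides (words not
  ending in the letter of the side's starting divisor), their end-regularised (`Shuffle.regEnd`,
  `log ↦ 0`) generating series `PHlo, PHhi, PVlo, PVhi` with coefficients `χ[·]` in any realisation
  `χ` of the rules; conclusion: `V_α(β) · H_0(α) = H_β(α) · V_0(β)` in `U𝔞₄ ⊗ R/(deg>N)`.
  MECHANISM (the line's lever, edge-normal Newton–Leibniz): a Poincaré-lemma induction on the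
  degree in which every derivative is an ENDPOINT derivative of a dilated family (Euler homogeneity
  `ξ∂_ξ p = Σᵢ ∂_{τᵢ}(τᵢ p)` + fibre rule-3 moves with the rational primitives `τᵢ p/ξ`, collisions
  cancelling identically), the degree-`n` comparison being 2-dimensional Stokes on the rectangle for
  the closed `U𝔞₄`-valued 1-form `(f W_{n-1} - W_{n-1}Z₀/ξ)dξ + (g W_{n-1} - W_{n-1}Z₁/η)dη` = two
  rule-3 moves across the normal coordinates of the two edges from their SPECIAL FIBRES `ξ = 0`,
  `η = 0` (primitive = the unfolded rational integrand, boundary term = honest evaluation at normal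
  coordinate `0`), closedness from `[f,g] = 0`, `∂_η f = ∂_ξ g`, `[Z₀,Z₁] = 0` and the induction
  hypothesis; no transverse derivative of a tangential family, no ε-inset, no limit, no `[log ε]`.
* `stub_cornersCubical` [L]: the principle instantiated at the three cubical vertices `(0,0)`,
  `(1,0)`, `(0,1)` of the cell (charts `(u,v)`, `(1-u,v)`, `(u,1-v)`; divisors
  `{ξ, η, 1-ξ, 1-η, 1-ξη}` resp. `{ξ, η, 1-ξ, 1-η, 1-η+ξη}`, `{ξ, η, 1-ξ, 1-η, 1-ξ+ξη}`), giving
  `M0M5 = M4M6`, `M0M7 = M1M8`, `M4M14 = M3M13` of the atlas (alphabet embedding/merging of letters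
  with equal densities, identification of classes by `EqOn`).
* `stub_cornersBlowup` [L]: the principle at the two vertices on the exceptional divisor over
  `(1,1)` (blow-up charts `(w', v) = ((1-u)/(1-v), 1-v)` and its mirror; divisors
  `{w', v, 1-w'v, 1-v, 1+w'-w'v}`), giving `M2M10 = M1M9`, `M2M11 = M3M12` (plus the scaling change of
  variables `x' = w'/2` onto the legs `1`, `3` of the atlas).

References: [Drinfeld1991, §2], [Furusho2011, §2], [KontsevichZagier2001, §1.2],
[IharaKanekoZagier2006, Cor. 5], [BrownModuli2009] (cellular/cubical coordinates and the blow-up at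
`(1,1)`); first lead's atlas and composition: `Lines/logfree-gauge-corner-flatness.lean`.
-/

noncomputable section

open Literature.NumberTheory.Transcendental

namespace Summit.KontsevichZagierPeriods.FurushoPentagon.PentagonInKZ

open Summit.KontsevichZagierPeriods.KontsevichZagierPeriods.Theses.FurushoPentagon (PentagonInKZ)

/-! ## 1. The registered stubs

`stub_pathFamilies` and `stub_groupLike` are LANDED (imported above, same namespace). -/

/-- **Stub `stub_shuffleProduct`** [M]: SHUFFLE = DISSECTION for the path simplices, at the
level of classes: for two words `u, v` not ending in the letter `0`, the Fubini product of the two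
simplex representations minus the sum of the representations of the shuffled words lies in
`KZ.relations` (the product `Δ_u × Δ_v` is, up to the null tie-walls, the disjoint union over the
interleavings `w ∈ u ш v` of cells that are coordinate permutations of the simplex `Δ_w`, with the
interleaved integrand: moves (1a) domain additivity, (2) `KZ.of_sub_of_reindex_mem_relations`, and
`KZ.of_mem_relations_of_volume_eq_zero` for the walls). [cite: Eie2013, §1.2] -/
theorem stub_shuffleProduct :
    ∀ (I : (p : Fin 15) → (w : List (Fin 3)) → KZ.IntegralRep w.length), (∀ (p : Fin 15) (w : List (Fin 3)), w.getLast? ≠ some 0 → (I p w).domain = {t | (∀ i, 0 < t i ∧ t i < (![1/2, 1/2, 1/2, 1/2, 1/2, 1/2, 1/2, 1/2, 1/2, 1/2, 1, 1, 1/2, 1/2, 1/2] : Fin 15 → ℝ) p) ∧ StrictAnti t} ∧ Set.EqOn (I p w).integrand (fun t => ∏ i, 1 / (t i - (![![0, 1, 2], ![0, 1, -1], ![0, 1, 2], ![0, 1, -1], ![0, 1, 2], ![0, 1, 2], ![0, 1, 2], ![0, 1, 2], ![0, 1, 2], ![0, 1, 2], ![0, -1, 2], ![0, -1, 2], ![0,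 1, 2], ![0, 1, 2], ![0, 1, 2]] : Fin 15 → Fin 3 → ℝ) p (w.get i))) (I p w).domain) → (∀ (p : Fin 15) (u v : List (Fin 3)), u.getLast? ≠ some 0 → v.getLast? ≠ some 0 → KZ.of (I p u) * KZ.of (I p v) - ((MZV.shuffleWord u v).map (fun w => KZ.of (I p w))).sum ∈ KZ.relations) := by
  sorry

/-- **Stub `stub_halfEdgeUniversal`** [L]: the UNIVERSAL HALF-EDGE IDENTITY. With
`A(X,Y) := (P 5)(X, Y, 0)` the log-free transport of `X dt/t + Y dt/(t-1)` over `(0, ½)` from the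
tangential base point at `0`, `λ := χ[∫₀^{1/2} dt/(t-1)] = [log ½]` and `Φ_χ` the crux series:
`A(Y,X) · e^{λY} · Φ_χ(X,Y) = A(X,Y) · e^{λX}` for all weight-one `X, Y` — the class-level form of
`Φ_KZ = G₁(½)⁻¹ G₀(½)` (composition of the two tangential half-transports at the midpoint
`t = ½`: dissection of the MZV simplex `1 > t₁ > ⋯ > t_n > 0` by the number of `tᵢ > ½`, Fubini,
the reflection `t ↦ 1 - t`, the antipode of the group-like `A`, and the regularisation algebra
`Shuffle.factorisation` / `MZV.shuffleReg = regFront ∘ regEnd`). [cite: Drinfeld1991, §2] -/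
theorem stub_halfEdgeUniversal :
    ∀ (R : Type) [CommRing R] [Algebra ℚ R] (χ : KZ.FormalRep →+ R), (∀ c ∈ KZ.relations, χ c = 0) → (∀ x y : KZ.FormalRep, χ (x * y) = χ x * χ y) → (∃ u : KZ.FormalRep, χ u = 1) → ∀ (Z : List ℕ → KZ.FormalRep), (∀ (u : List ℕ) (hu : MZV.IsAdmissible u), Z u = KZ.of (KZ.mzvRep u hu (KZ.mzvIntegrand_isSemialgebraicFunOn_holds u) (KZ.mzvIntegrand_integrableOn_holds u hu))) → ∀ (φ : NCSeries Bool R), (φ = fun W : List Bool => (-1 : R) ^ (W.count true) * (MZV.shuffleReg W).sum (fun v a => a • (if MZV.IsConvergentWord v then χ (Z (MZV.ofBinaryWord v)) else (0 : R)))) → ∀ (I : (p : Fin 15) → (w : List (Fin 3)) → KZ.IntegralRep w.length), (∀ (p : Fin 15) (w : List (Fin 3)), w.getLast? ≠ some 0 → (I p w).domain = {t | (∀ i, 0 < t i ∧ t i < (![1/2, 1/2, 1/2, 1/2, 1/2, 1/2, 1/2, 1/2, 1/2, 1/2, 1, 1, 1/2, 1/2, 1/2] : Fin 15 → ℝ)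 p) ∧ StrictAnti t} ∧ Set.EqOn (I p w).integrand (fun t => ∏ i, 1 / (t i - (![![0, 1, 2], ![0, 1, -1], ![0, 1, 2], ![0, 1, -1], ![0, 1, 2], ![0, 1, 2], ![0, 1, 2], ![0, 1, 2], ![0, 1, 2], ![0, 1, 2], ![0, -1, 2], ![0, -1, 2], ![0, 1, 2], ![0, 1, 2], ![0, 1, 2]] : Fin 15 → Fin 3 → ℝ) p (w.get i))) (I p w).domain) → ∀ (P : Fin 15 → NCSeries (Fin 3) R), (∀ (p : Fin 15) (W : List (Fin 3)), P p W = if W = [] then 1 else Shuffle.pair (fun w => χ (KZ.of (I p w))) (Shuffle.regEnd 0 W)) → (∀ p : Fin 15, NCSeries.IsGroupLike (P p)) → ∀ (N : ℕ) (x y : DrinfeldKohnoTrunc R (Fin 4) N), x ∈ (DrinfeldKohnoTrunc.genSpan : Submodule R (DrinfeldKohnoTrunc R (Fin 4) N)) → y ∈ (DrinfeldKohnoTrunc.genSpan : Submodule R (DrinfeldKohnoTrunc R (Fin 4) N)) → NCSeries.evalTrunc N (![y, x, 0] : Fin 3 → DrinfeldKohnoTrunc R (Fin 4) N) (P 5)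 * truncExp R N (χ (KZ.of (I 5 [1])) • y) * NCSeries.subst₂ N φ x y = NCSeries.evalTrunc N (![x, y, 0] : Fin 3 → DrinfeldKohnoTrunc R (Fin 4) N) (P 5) * truncExp R N (χ (KZ.of (I 5 [1])) • x) := by
  sorry

/-- **Stub `stub_chartB`** [M]: the CHART IDENTITY between the two half-edge families. With
`B(X,W) := (P 10)(X, W, 0)` the log-free transport of `X ds/s + W ds/(s+1)` over `(0, 1)` from the
tangential base point at `0` (paths 10, 11: the edge `t₁₂ — t₂₃` read in the charts
`s = τ/(1-τ)` centred at its two vertices, midpoint at `s = 1`): `B(X,W) = A(X, -X-W) · e^{λX}`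
for all weight-one `X, W` — the change of variables `s = τ/(1-τ)` (`ds/s = dτ/τ - dτ/(τ-1)`,
`ds/(s+1) = -dτ/(τ-1)`, integrand additivity) on words not ending in `0`, extended to all words by
the end-regularisation algebra of the two group-like series (the factor `e^{λX}` is the change of
scale `log 1 = 0` versus `log ½` at the endpoint). [folklore] -/
theorem stub_chartB :
    ∀ (R : Type) [CommRing R] [Algebra ℚ R] (χ : KZ.FormalRep →+ R), (∀ c ∈ KZ.relations, χ c = 0) → (∀ x y : KZ.FormalRep, χ (x * y) = χ x * χ y) → (∃ u : KZ.FormalRep, χ u = 1) → ∀ (I : (p : Fin 15) → (w : List (Fin 3)) → KZ.IntegralRep w.length), (∀ (p : Fin 15) (w : List (Fin 3)), w.getLast? ≠ some 0 → (I p w).domain = {t | (∀ i, 0 < t i ∧ t i < (![1/2, 1/2, 1/2, 1/2, 1/2, 1/2, 1/2, 1/2, 1/2, 1/2, 1, 1, 1/2, 1/2, 1/2] : Fin 15 → ℝ) p) ∧ StrictAnti t} ∧ Set.EqOn (I p w).integrand (fun t => ∏ i, 1 / (t i - (![![0, 1, 2], ![0, 1, -1], ![0, 1, 2], ![0, 1,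 -1], ![0, 1, 2], ![0, 1, 2], ![0, 1, 2], ![0, 1, 2], ![0, 1, 2], ![0, 1, 2], ![0, -1, 2], ![0, -1, 2], ![0, 1, 2], ![0, 1, 2], ![0, 1, 2]] : Fin 15 → Fin 3 → ℝ) p (w.get i))) (I p w).domain) → ∀ (P : Fin 15 → NCSeries (Fin 3) R), (∀ (p : Fin 15) (W : List (Fin 3)), P p W = if W = [] then 1 else Shuffle.pair (fun w => χ (KZ.of (I p w))) (Shuffle.regEnd 0 W)) → (∀ p : Fin 15, NCSeries.IsGroupLike (P p)) → ∀ (N : ℕ) (x w : DrinfeldKohnoTrunc R (Fin 4) N), x ∈ (DrinfeldKohnoTrunc.genSpan : Submodule R (DrinfeldKohnoTrunc R (Fin 4) N)) → w ∈ (DrinfeldKohnoTrunc.genSpan : Submodule R (DrinfeldKohnoTrunc R (Fin 4) N)) → NCSeries.evalTrunc N (![x, w, 0] : Fin 3 → DrinfeldKohnoTrunc R (Fin 4) N) (P 10) = NCSeries.evalTrunc N (![x, -x - w, 0] : Fin 3 → DrinfeldKohnoTrunc R (Fin 4) N) (P 5) * truncExp R N (χ (KZ.of (I 5 [1])) • x)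 := by
  sorry

/-- **Stub `stub_cornerPrinciple`** [XL, hardest; held by the lead]: the general LOG-FREE CORNER
PRINCIPLE for a flat rational KZ-type connection with bilinear divisors in a product chart
`[0,α] × [0,β]` of a normal-crossing vertex whose two edge residues are central on their edges:
in every realisation `χ` of the rules, the end-regularised transports along the four sides satisfy
`V_α(β) · H_0(α) = H_β(α) · V_0(β)` in `U𝔞₄ ⊗ R/(deg > N)`.  Letters `k : Fin (m+2)` = divisors
`φ_k = a_k + b_k ξ + c_k η + d_k ξη` (`cf k = ![a_k,b_k,c_k,d_k]`, `φ₀ = ξ`, `φ₁ = η`), horizontal /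
vertical letter densities `f_k = ∂_ξ log φ_k`, `g_k = ∂_η log φ_k`, residues
`Z_k = Σ_{ij} nZ k i j · t_ij`; the horizontal families (`IHlo` at height `0`, `IHhi` at height `β`)
run in `ξ` from the divisor `ξ = 0` to `α` and are end-regularised in the letter `0`, the vertical
ones (`IVlo` at abscissa `0`, `IVhi` at abscissa `α`) run in `η` from `η = 0` to `β`, end-regularised
in the letter `1`.  Proof shape: Poincaré-lemma induction on the degree by endpoint (Euler) fibre
Newton–Leibniz moves of the dilated families and two rule-3 moves across the normal coordinates of
the two edges from their special fibres (see the module docstring). [cite: Drinfeld1991, §2] -/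
theorem stub_cornerPrinciple :
    ∀ (R : Type) [CommRing R] [Algebra ℚ R] (χ : KZ.FormalRep →+ R), (∀ c ∈ KZ.relations, χ c = 0) → (∀ x y : KZ.FormalRep, χ (x * y) = χ x * χ y) → (∃ u : KZ.FormalRep, χ u = 1) → ∀ (m N : ℕ) (α β : ℚ), 0 < α → 0 < β → ∀ (cf : Fin (m + 2) → Fin 4 → ℚ), cf 0 = ![0, 1, 0, 0] → cf 1 = ![0, 0, 1, 0] → ∀ (φ f g : Fin (m + 2) → ℝ → ℝ → ℝ), (∀ k x y, φ k x y = cf k 0 + cf k 1 * x + cf k 2 * y + cf k 3 * x * y) → (∀ k x y, f k x y = (cf k 1 + cf k 3 * y) / φ k x y) → (∀ k x y, g k x y = (cf k 2 + cf k 3 * x) / φ k x y) → (∀ k : Fin (m + 2), k ≠ 0 → k ≠ 1 → ∀ x y : ℝ, 0 ≤ x → x ≤ (α : ℝ) → 0 ≤ y → y ≤ (β : ℝ) → φ k x y ≠ 0) → ∀ (nZ : Fin (m + 2) → Fin 4 → Fin 4 → ℤ) (Zr : Fin (m + 2) → DrinfeldKohnoTrunc ℝ (Fin 4) N), (∀ k,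 Zr k = ∑ i : Fin 4, ∑ j : Fin 4, (nZ k i j : ℝ) • DrinfeldKohnoTrunc.t ℝ N i j) → Zr 0 * Zr 1 = Zr 1 * Zr 0 → (∀ x y : ℝ, 0 < x → x < (α : ℝ) → 0 < y → y < (β : ℝ) → ∑ k : Fin (m + 2), ∑ l : Fin (m + 2), (f k x y * g l x y) • (Zr k * Zr l - Zr l * Zr k) = 0) → (∀ y : ℝ, 0 < y → y < (β : ℝ) → ∑ l : Fin (m + 2), g l 0 y • (Zr 0 * Zr l - Zr l * Zr 0) = 0) → (∀ x : ℝ, 0 < x → x < (α : ℝ) → ∑ k : Fin (m + 2), f k x 0 • (Zr 1 * Zr k - Zr k * Zr 1) = 0) → ∀ (IHlo IHhi IVlo IVhi : (w : List (Fin (m + 2))) → KZ.IntegralRep w.length), (∀ w : List (Fin (m + 2)), w.getLast? ≠ some 0 → (IHlo w).domain = {t | (∀ i, 0 < t i ∧ t i < (α : ℝ)) ∧ StrictAnti t} ∧ Set.EqOn (IHlo w).integrand (fun t => ∏ i, f (w.get i) (t i) 0) (IHlo w).domain) → (∀ w : List (Fin (m + 2)), w.getLast? ≠ some 0 → (IHhi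 w).domain = {t | (∀ i, 0 < t i ∧ t i < (α : ℝ)) ∧ StrictAnti t} ∧ Set.EqOn (IHhi w).integrand (fun t => ∏ i, f (w.get i) (t i) (β : ℝ)) (IHhi w).domain) → (∀ w : List (Fin (m + 2)), w.getLast? ≠ some 1 → (IVlo w).domain = {t | (∀ i, 0 < t i ∧ t i < (β : ℝ)) ∧ StrictAnti t} ∧ Set.EqOn (IVlo w).integrand (fun t => ∏ i, g (w.get i) 0 (t i)) (IVlo w).domain) → (∀ w : List (Fin (m + 2)), w.getLast? ≠ some 1 → (IVhi w).domain = {t | (∀ i, 0 < t i ∧ t i < (β : ℝ)) ∧ StrictAnti t} ∧ Set.EqOn (IVhi w).integrand (fun t => ∏ i, g (w.get i) (α : ℝ) (t i)) (IVhi w).domain) → ∀ (PHlo PHhi PVlo PVhi : NCSeries (Fin (m + 2)) R), (∀ W, PHlo W = if W = [] then 1 else Shuffle.pair (fun w => χ (KZ.of (IHlo w))) (Shuffle.regEnd 0 W)) → (∀ W, PHhi W = if W = [] then 1 else Shuffle.pair (fun w => χ (KZ.of (IHhi w))) (Shuffle.regEnd 0 W)) → (∀ W, PVlo W = if W = [] then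 1 else Shuffle.pair (fun w => χ (KZ.of (IVlo w))) (Shuffle.regEnd 1 W)) → (∀ W, PVhi W = if W = [] then 1 else Shuffle.pair (fun w => χ (KZ.of (IVhi w))) (Shuffle.regEnd 1 W)) → ∀ (Z : Fin (m + 2) → DrinfeldKohnoTrunc R (Fin 4) N), (∀ k, Z k = ∑ i : Fin 4, ∑ j : Fin 4, (nZ k i j : R) • DrinfeldKohnoTrunc.t R N i j) → NCSeries.evalTrunc N Z PVhi * NCSeries.evalTrunc N Z PHlo = NCSeries.evalTrunc N Z PHhi * NCSeries.evalTrunc N Z PVlo := by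
  sorry

/-- **Stub `stub_cornersCubical`** [L]: the corner principle (hypothesis, verbatim the statement of
`stub_cornerPrinciple`) instantiated at the three CUBICAL vertices of the pentagon cell
`{0 < x < y < 1}` read in the chart `x = uv, y = v` — vertex `(0,0)` (chart `(u,v)`, divisors
`u, v, 1-u, 1-v, 1-uv`, residues `t₀₁, t₀₁+t₀₂+t₁₂, t₁₂, t₂₃, t₁₃`), vertex `(1,0)` (chart `(1-u, v)`,
fifth divisor `1-v+ξv`), vertex `(0,1)` (chart `(u, 1-v)`, fifth divisor `1-ξ+ξη`) — gives the corner
identities `M0M5 = M4M6`, `M0M7 = M1M8`, `M4M14 = M3M13` of the fifteen-path atlas (words of the atlas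
alphabet `Fin 3` embed into the chart alphabet `Fin 5`; letters with equal densities on an edge merge
with added residues; classes are identified by `KZ.of_sub_of_mem_relations_of_eqOn`). [cite: Drinfeld1991, §2] -/
theorem stub_cornersCubical :
    (∀ (R : Type) [CommRing R] [Algebra ℚ R] (χ : KZ.FormalRep →+ R), (∀ c ∈ KZ.relations, χ c = 0) → (∀ x y : KZ.FormalRep, χ (x * y) = χ x * χ y) → (∃ u : KZ.FormalRep, χ u = 1) → ∀ (m N : ℕ) (α β : ℚ), 0 < α → 0 < β → ∀ (cf : Fin (m + 2) → Fin 4 → ℚ), cf 0 = ![0, 1, 0, 0] → cf 1 = ![0, 0, 1, 0] → ∀ (φ f g : Fin (m + 2) → ℝ → ℝ → ℝ), (∀ k x y, φ k x y = cf k 0 + cf k 1 * x + cf k 2 * y + cf k 3 * x * y) → (∀ k x y, f k x y = (cf k 1 + cf k 3 * y) / φ k x y) → (∀ k x y, g k x y = (cf k 2 + cf k 3 * x) / φ k x y) → (∀ k : Fin (m + 2), k ≠ 0 → k ≠ 1 → ∀ x y : ℝ, 0 ≤ x → x ≤ (α : ℝ) → 0 ≤ y → y ≤ (β : ℝ) →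 φ k x y ≠ 0) → ∀ (nZ : Fin (m + 2) → Fin 4 → Fin 4 → ℤ) (Zr : Fin (m + 2) → DrinfeldKohnoTrunc ℝ (Fin 4) N), (∀ k, Zr k = ∑ i : Fin 4, ∑ j : Fin 4, (nZ k i j : ℝ) • DrinfeldKohnoTrunc.t ℝ N i j) → Zr 0 * Zr 1 = Zr 1 * Zr 0 → (∀ x y : ℝ, 0 < x → x < (α : ℝ) → 0 < y → y < (β : ℝ) → ∑ k : Fin (m + 2), ∑ l : Fin (m + 2), (f k x y * g l x y) • (Zr k * Zr l - Zr l * Zr k) = 0) → (∀ y : ℝ, 0 < y → y < (β : ℝ) → ∑ l : Fin (m + 2), g l 0 y • (Zr 0 * Zr l - Zr l * Zr 0) = 0) → (∀ x : ℝ, 0 < x → x < (α : ℝ) → ∑ k : Fin (m + 2), f k x 0 • (Zr 1 * Zr k - Zr k * Zr 1) = 0) → ∀ (IHlo IHhi IVlo IVhi : (w : List (Fin (m + 2))) → KZ.IntegralRep w.length), (∀ w : List (Fin (m + 2)), w.getLast? ≠ some 0 → (IHlo w).domain = {t | (∀ i, 0 < t i ∧ t i < (α : ℝ)) ∧ StrictAnti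 t} ∧ Set.EqOn (IHlo w).integrand (fun t => ∏ i, f (w.get i) (t i) 0) (IHlo w).domain) → (∀ w : List (Fin (m + 2)), w.getLast? ≠ some 0 → (IHhi w).domain = {t | (∀ i, 0 < t i ∧ t i < (α : ℝ)) ∧ StrictAnti t} ∧ Set.EqOn (IHhi w).integrand (fun t => ∏ i, f (w.get i) (t i) (β : ℝ)) (IHhi w).domain) → (∀ w : List (Fin (m + 2)), w.getLast? ≠ some 1 → (IVlo w).domain = {t | (∀ i, 0 < t i ∧ t i < (β : ℝ)) ∧ StrictAnti t} ∧ Set.EqOn (IVlo w).integrand (fun t => ∏ i, g (w.get i) 0 (t i)) (IVlo w).domain) → (∀ w : List (Fin (m + 2)), w.getLast? ≠ some 1 → (IVhi w).domain = {t | (∀ i, 0 < t i ∧ t i < (β : ℝ)) ∧ StrictAnti t} ∧ Set.EqOn (IVhi w).integrand (fun t => ∏ i, g (w.get i) (α : ℝ) (t i)) (IVhi w).domain) → ∀ (PHlo PHhi PVlo PVhi : NCSeries (Fin (m + 2)) R), (∀ W, PHlo W = if W = [] then 1 else Shuffle.pair (fun w => χ (KZ.of (IHlo w))) (Shuffle.regEnd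 0 W)) → (∀ W, PHhi W = if W = [] then 1 else Shuffle.pair (fun w => χ (KZ.of (IHhi w))) (Shuffle.regEnd 0 W)) → (∀ W, PVlo W = if W = [] then 1 else Shuffle.pair (fun w => χ (KZ.of (IVlo w))) (Shuffle.regEnd 1 W)) → (∀ W, PVhi W = if W = [] then 1 else Shuffle.pair (fun w => χ (KZ.of (IVhi w))) (Shuffle.regEnd 1 W)) → ∀ (Z : Fin (m + 2) → DrinfeldKohnoTrunc R (Fin 4) N), (∀ k, Z k = ∑ i : Fin 4, ∑ j : Fin 4, (nZ k i j : R) • DrinfeldKohnoTrunc.t R N i j) → NCSeries.evalTrunc N Z PVhi * NCSeries.evalTrunc N Z PHlo = NCSeries.evalTrunc N Z PHhi * NCSeries.evalTrunc N Z PVlo) → ∀ (R : Type) [CommRing R] [Algebra ℚ R] (χ : KZ.FormalRep →+ R), (∀ c ∈ KZ.relations, χ c = 0) → (∀ x y : KZ.FormalRep, χ (x * y) = χ x * χ y) → (∃ u : KZ.FormalRep, χ u = 1) → ∀ (I : (p : Fin 15) → (w : List (Fin 3)) → KZ.IntegralRep w.length), (∀ (p : Fin 15) (w : List (Fin 3)),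 w.getLast? ≠ some 0 → (I p w).domain = {t | (∀ i, 0 < t i ∧ t i < (![1/2, 1/2, 1/2, 1/2, 1/2, 1/2, 1/2, 1/2, 1/2, 1/2, 1, 1, 1/2, 1/2, 1/2] : Fin 15 → ℝ) p) ∧ StrictAnti t} ∧ Set.EqOn (I p w).integrand (fun t => ∏ i, 1 / (t i - (![![0, 1, 2], ![0, 1, -1], ![0, 1, 2], ![0, 1, -1], ![0, 1, 2], ![0, 1, 2], ![0, 1, 2], ![0, 1, 2], ![0, 1, 2], ![0, 1, 2], ![0, -1, 2], ![0, -1, 2], ![0, 1, 2], ![0, 1, 2], ![0, 1, 2]] : Fin 15 → Fin 3 → ℝ) p (w.get i))) (I p w).domain) → ∀ (P : Fin 15 → NCSeries (Fin 3) R), (∀ (p : Fin 15) (W : List (Fin 3)), P p W = if W = [] then 1 else Shuffle.pair (fun w => χ (KZ.of (I p w))) (Shuffle.regEnd 0 W)) → ∀ (N : ℕ) (a b c d e : DrinfeldKohnoTrunc R (Fin 4) N), a = DrinfeldKohnoTrunc.t R N 0 1 → b = DrinfeldKohnoTrunc.t R N 0 2 → c = DrinfeldKohnoTrunc.t R N 1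 2 → d = DrinfeldKohnoTrunc.t R N 1 3 → e = DrinfeldKohnoTrunc.t R N 2 3 → ∀ (M : Fin 15 → DrinfeldKohnoTrunc R (Fin 4) N), (∀ p : Fin 15, M p = NCSeries.evalTrunc N ((![![a + b + c, e, d], ![c, a, d], ![c + d + e, a + a + b + c, d], ![e, a + b + c, d], ![a, c, d], ![a, c, 0], ![a + b + c, e, 0], ![c, a, 0], ![a + b + c, d + e, 0], ![c + d + e, a + b + c, 0], ![c, d, 0], ![e, d, 0], ![c + d + e, a, 0], ![a, c + d, 0], ![e, a + b + c, 0]] : Fin 15 → Fin 3 → DrinfeldKohnoTrunc R (Fin 4) N) p) (P p)) → M 0 * M 5 = M 4 * M 6 ∧ M 0 * M 7 = M 1 * M 8 ∧ M 4 * M 14 = M 3 * M 13 := by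
  sorry

/-- **Stub `stub_cornersBlowup`** [L]: the corner principle (hypothesis, verbatim) instantiated at the
two vertices of the cell lying on the exceptional divisor of the blow-up of `(u,v) = (1,1)` — charts
`(w', v') = ((1-u)/(1-v), 1-v)` and `(w, u') = ((1-v)/(1-u), 1-u)`, divisors
`w', v', 1-w'v', 1-v', 1+w'-w'v'` with residues `t₁₂, t₁₂+t₁₃+t₂₃, t₀₁, t₀₁+t₀₂+t₁₂, t₁₃` (resp. the
mirror data) — gives `M2M10 = M1M9` and `M2M11 = M3M12` of the atlas; the legs `1`, `3` (bound `1/2`,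
poles `0, 1, -1`) are the horizontal sides at height `v' = 1/2` (bound `1`, poles `0, 2, -2`) after the
scaling change of variables `x' = w'/2`. [cite: BrownModuli2009, §2] -/
theorem stub_cornersBlowup :
    (∀ (R : Type) [CommRing R] [Algebra ℚ R] (χ : KZ.FormalRep →+ R), (∀ c ∈ KZ.relations, χ c = 0) → (∀ x y : KZ.FormalRep, χ (x * y) = χ x * χ y) → (∃ u : KZ.FormalRep, χ u = 1) → ∀ (m N : ℕ) (α β : ℚ), 0 < α → 0 < β → ∀ (cf : Fin (m + 2) → Fin 4 → ℚ), cf 0 = ![0, 1, 0, 0] → cf 1 = ![0, 0, 1, 0] → ∀ (φ f g : Fin (m + 2) → ℝ → ℝ → ℝ), (∀ k x y, φ k x y = cf k 0 + cf k 1 * x + cf k 2 * y + cf k 3 * x * y) → (∀ k x y, f k x y = (cf k 1 + cf k 3 * y) / φ k x y) → (∀ k x y, g k x y = (cf k 2 + cf k 3 * x) / φ k x y) → (∀ k : Fin (m + 2), k ≠ 0 → k ≠ 1 → ∀ x y : ℝ, 0 ≤ x → x ≤ (α : ℝ) → 0 ≤ y → y ≤ (β : ℝ) → φ k x y ≠ 0)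 → ∀ (nZ : Fin (m + 2) → Fin 4 → Fin 4 → ℤ) (Zr : Fin (m + 2) → DrinfeldKohnoTrunc ℝ (Fin 4) N), (∀ k, Zr k = ∑ i : Fin 4, ∑ j : Fin 4, (nZ k i j : ℝ) • DrinfeldKohnoTrunc.t ℝ N i j) → Zr 0 * Zr 1 = Zr 1 * Zr 0 → (∀ x y : ℝ, 0 < x → x < (α : ℝ) → 0 < y → y < (β : ℝ) → ∑ k : Fin (m + 2), ∑ l : Fin (m + 2), (f k x y * g l x y) • (Zr k * Zr l - Zr l * Zr k) = 0) → (∀ y : ℝ, 0 < y → y < (β : ℝ) → ∑ l : Fin (m + 2), g l 0 y • (Zr 0 * Zr l - Zr l * Zr 0) = 0) → (∀ x : ℝ, 0 < x → x < (α : ℝ) → ∑ k : Fin (m + 2), f k x 0 • (Zr 1 * Zr k - Zr k * Zr 1) = 0) → ∀ (IHlo IHhi IVlo IVhi : (w : List (Fin (m + 2))) → KZ.IntegralRep w.length), (∀ w : List (Fin (m + 2)), w.getLast? ≠ some 0 → (IHlo w).domain = {t | (∀ i, 0 < t i ∧ t i < (α : ℝ)) ∧ StrictAnti t} ∧ Set.EqOn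 (IHlo w).integrand (fun t => ∏ i, f (w.get i) (t i) 0) (IHlo w).domain) → (∀ w : List (Fin (m + 2)), w.getLast? ≠ some 0 → (IHhi w).domain = {t | (∀ i, 0 < t i ∧ t i < (α : ℝ)) ∧ StrictAnti t} ∧ Set.EqOn (IHhi w).integrand (fun t => ∏ i, f (w.get i) (t i) (β : ℝ)) (IHhi w).domain) → (∀ w : List (Fin (m + 2)), w.getLast? ≠ some 1 → (IVlo w).domain = {t | (∀ i, 0 < t i ∧ t i < (β : ℝ)) ∧ StrictAnti t} ∧ Set.EqOn (IVlo w).integrand (fun t => ∏ i, g (w.get i) 0 (t i)) (IVlo w).domain) → (∀ w : List (Fin (m + 2)), w.getLast? ≠ some 1 → (IVhi w).domain = {t | (∀ i, 0 < t i ∧ t i < (β : ℝ)) ∧ StrictAnti t} ∧ Set.EqOn (IVhi w).integrand (fun t => ∏ i, g (w.get i) (α : ℝ) (t i)) (IVhi w).domain) → ∀ (PHlo PHhi PVlo PVhi : NCSeries (Fin (m + 2)) R), (∀ W, PHlo W = if W = [] then 1 else Shuffle.pair (fun w => χ (KZ.of (IHlo w))) (Shuffle.regEnd 0 W)) → (∀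 W, PHhi W = if W = [] then 1 else Shuffle.pair (fun w => χ (KZ.of (IHhi w))) (Shuffle.regEnd 0 W)) → (∀ W, PVlo W = if W = [] then 1 else Shuffle.pair (fun w => χ (KZ.of (IVlo w))) (Shuffle.regEnd 1 W)) → (∀ W, PVhi W = if W = [] then 1 else Shuffle.pair (fun w => χ (KZ.of (IVhi w))) (Shuffle.regEnd 1 W)) → ∀ (Z : Fin (m + 2) → DrinfeldKohnoTrunc R (Fin 4) N), (∀ k, Z k = ∑ i : Fin 4, ∑ j : Fin 4, (nZ k i j : R) • DrinfeldKohnoTrunc.t R N i j) → NCSeries.evalTrunc N Z PVhi * NCSeries.evalTrunc N Z PHlo = NCSeries.evalTrunc N Z PHhi * NCSeries.evalTrunc N Z PVlo) → ∀ (R : Type) [CommRing R] [Algebra ℚ R] (χ : KZ.FormalRep →+ R), (∀ c ∈ KZ.relations, χ c = 0) → (∀ x y : KZ.FormalRep, χ (x * y) = χ x * χ y) → (∃ u : KZ.FormalRep, χ u = 1) → ∀ (I : (p : Fin 15) → (w : List (Fin 3)) → KZ.IntegralRep w.length), (∀ (p : Fin 15) (w : List (Fin 3)), w.getLast? ≠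 some 0 → (I p w).domain = {t | (∀ i, 0 < t i ∧ t i < (![1/2, 1/2, 1/2, 1/2, 1/2, 1/2, 1/2, 1/2, 1/2, 1/2, 1, 1, 1/2, 1/2, 1/2] : Fin 15 → ℝ) p) ∧ StrictAnti t} ∧ Set.EqOn (I p w).integrand (fun t => ∏ i, 1 / (t i - (![![0, 1, 2], ![0, 1, -1], ![0, 1, 2], ![0, 1, -1], ![0, 1, 2], ![0, 1, 2], ![0, 1, 2], ![0, 1, 2], ![0, 1, 2], ![0, 1, 2], ![0, -1, 2], ![0, -1, 2], ![0, 1, 2], ![0, 1, 2], ![0, 1, 2]] : Fin 15 → Fin 3 → ℝ) p (w.get i))) (I p w).domain) → ∀ (P : Fin 15 → NCSeries (Fin 3) R), (∀ (p : Fin 15) (W : List (Fin 3)), P p W = if W = [] then 1 else Shuffle.pair (fun w => χ (KZ.of (I p w))) (Shuffle.regEnd 0 W)) → ∀ (N : ℕ) (a b c d e : DrinfeldKohnoTrunc R (Fin 4) N), a = DrinfeldKohnoTrunc.t R N 0 1 → b = DrinfeldKohnoTrunc.t R N 0 2 → c = DrinfeldKohnoTrunc.t R N 1 2 → d = DrinfeldKohnoTrunc.t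 R N 1 3 → e = DrinfeldKohnoTrunc.t R N 2 3 → ∀ (M : Fin 15 → DrinfeldKohnoTrunc R (Fin 4) N), (∀ p : Fin 15, M p = NCSeries.evalTrunc N ((![![a + b + c, e, d], ![c, a, d], ![c + d + e, a + a + b + c, d], ![e, a + b + c, d], ![a, c, d], ![a, c, 0], ![a + b + c, e, 0], ![c, a, 0], ![a + b + c, d + e, 0], ![c + d + e, a + b + c, 0], ![c, d, 0], ![e, d, 0], ![c + d + e, a, 0], ![a, c + d, 0], ![e, a + b + c, 0]] : Fin 15 → Fin 3 → DrinfeldKohnoTrunc R (Fin 4) N) p) (P p)) → M 2 * M 10 = M 1 * M 9 ∧ M 2 * M 11 = M 3 * M 12 := by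
  sorry

/-- **The five log-free corner identities** (the first lead's `stub_logfreeCorners`, verbatim
signature), from the corner principle and its two instantiations. [cite: Drinfeld1991, §2] -/
theorem logfreeCorners :
    ∀ (R : Type) [CommRing R] [Algebra ℚ R] (χ : KZ.FormalRep →+ R), (∀ c ∈ KZ.relations, χ c = 0) → (∀ x y : KZ.FormalRep, χ (x * y) = χ x * χ y) → (∃ u : KZ.FormalRep, χ u = 1) → ∀ (I : (p : Fin 15) → (w : List (Fin 3)) → KZ.IntegralRep w.length), (∀ (p : Fin 15) (w : List (Fin 3)), w.getLast? ≠ some 0 → (I p w).domain = {t | (∀ i, 0 < t i ∧ t i < (![1/2, 1/2, 1/2, 1/2, 1/2, 1/2, 1/2, 1/2, 1/2, 1/2, 1, 1, 1/2, 1/2, 1/2] : Fin 15 → ℝ) p) ∧ StrictAnti t} ∧ Set.EqOn (I p w).integrand (fun t => ∏ i, 1 / (t i - (![![0, 1, 2], ![0, 1, -1], ![0, 1, 2], ![0, 1, -1], ![0, 1, 2], ![0, 1, 2], ![0, 1, 2], ![0, 1, 2], ![0, 1, 2], ![0, 1, 2], ![0, -1, 2], ![0, -1, 2], ![0, 1,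 2], ![0, 1, 2], ![0, 1, 2]] : Fin 15 → Fin 3 → ℝ) p (w.get i))) (I p w).domain) → ∀ (P : Fin 15 → NCSeries (Fin 3) R), (∀ (p : Fin 15) (W : List (Fin 3)), P p W = if W = [] then 1 else Shuffle.pair (fun w => χ (KZ.of (I p w))) (Shuffle.regEnd 0 W)) → ∀ (N : ℕ) (a b c d e : DrinfeldKohnoTrunc R (Fin 4) N), a = DrinfeldKohnoTrunc.t R N 0 1 → b = DrinfeldKohnoTrunc.t R N 0 2 → c = DrinfeldKohnoTrunc.t R N 1 2 → d = DrinfeldKohnoTrunc.t R N 1 3 → e = DrinfeldKohnoTrunc.t R N 2 3 → ∀ (M : Fin 15 → DrinfeldKohnoTrunc R (Fin 4) N), (∀ p : Fin 15, M p = NCSeries.evalTrunc N ((![![a + b + c, e, d], ![c, a, d], ![c + d + e, a + a + b + c, d], ![e, a + b + c, d], ![a, c, d], ![a, c, 0], ![a + b + c, e, 0], ![c, a, 0], ![a + b + c, d + e, 0], ![c + d + e, a + b + c, 0], ![c, d, 0], ![e, d, 0], ![c + d + e, a, 0], ![a, c + d, 0], ![e, a + b + c, 0]] : Fin 15 → Fin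 3 → DrinfeldKohnoTrunc R (Fin 4) N) p) (P p)) → M 0 * M 5 = M 4 * M 6 ∧ M 0 * M 7 = M 1 * M 8 ∧ M 2 * M 10 = M 1 * M 9 ∧ M 2 * M 11 = M 3 * M 12 ∧ M 4 * M 14 = M 3 * M 13 := by
  intro R _ _ χ hrel hmul hunit I hI P hP N a b c d e ha hb hc hd he M hM
  obtain ⟨C1, C2, C5⟩ := stub_cornersCubical stub_cornerPrinciple R χ hrel hmul hunit I hI P hP N a b c d
    e ha hb hc hd he M hM
  obtain ⟨C3, C4⟩ := stub_cornersBlowup stub_cornerPrinciple R χ hrel hmul hunit I hI P hP N a b c d e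
    ha hb hc hd he M hM
  exact ⟨C1, C2, C3, C4, C5⟩

/-! ## 2. Algebra in the truncated Drinfeld–Kohno algebra -/

section Algebra

variable {R : Type} [CommRing R] [Algebra ℚ R] {N : ℕ}

local notation "DK" => DrinfeldKohnoTrunc R (Fin 4) N

omit [Algebra ℚ R] in
/-- An element commuting with every value of the substitution commutes with the truncated
evaluation of any series. [folklore] -/
theorem commute_evalTrunc {α : Type} [Fintype α] {A : Type} [Ring A] [Algebra R A] {x : A}
    {v : α → A} (hv : ∀ i, Commute x (v i)) (n : ℕ) (S : NCSeries α R) :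
    Commute x (NCSeries.evalTrunc n v S) := by
  unfold NCSeries.evalTrunc
  refine Commute.sum_right _ _ _ fun k _ => Commute.sum_right _ _ _ fun f _ => ?_
  refine Commute.smul_right ?_ _
  exact Commute.list_prod_right _ _ fun y hy => by
    obtain ⟨i, -, rfl⟩ := List.mem_map.mp hy
    exact hv i

omit [Algebra ℚ R] in
/-- The truncated evaluation of a series with constant term `1` at weight-one values is a unit.
[folklore] -/
theorem isUnit_evalTrunc_of_mem {α : Type} [Fintype α] [DecidableEq α] {v : α → DK}
    (hv : ∀ i, v i ∈ (DrinfeldKohnoTrunc.genSpan : Submodule R DK)) {S : NCSeries α R}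
    (hS : S [] = 1) : IsUnit (NCSeries.evalTrunc N v S) :=
  NCSeries.isUnit_evalTrunc N v (DrinfeldKohnoTrunc.prod_map_eq_zero_of_mem_genSpan v hv) hS

/-- `e^{r x} e^{r y} = e^{r (x + y)}` for commuting weight-one `x, y`. [folklore] -/
theorem truncExp_smul_mul_truncExp_smul {x y : DK} (hxy : Commute x y)
    (hx : x ∈ (DrinfeldKohnoTrunc.genSpan : Submodule R DK))
    (hy : y ∈ (DrinfeldKohnoTrunc.genSpan : Submodule R DK)) (r : R) :
    truncExp R N (r • x) * truncExp R N (r • y) = truncExp R N (r • (x + y)) := by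
  rw [smul_add, ← truncExp_add_of_commute N ((hxy.smul_left r).smul_right r)
    (DrinfeldKohnoTrunc.pow_eq_zero_of_mem_genSpan (Submodule.smul_mem _ _ hx))
    (DrinfeldKohnoTrunc.pow_eq_zero_of_mem_genSpan (Submodule.smul_mem _ _ hy))
    (DrinfeldKohnoTrunc.pow_eq_zero_of_mem_genSpan
      (Submodule.add_mem _ (Submodule.smul_mem _ _ hx) (Submodule.smul_mem _ _ hy)))]

/-- `e^{r x}` is a unit for weight-one `x`. [folklore] -/
theorem isUnit_truncExp_smul {x : DK} (hx : x ∈ (DrinfeldKohnoTrunc.genSpan : Submodule R DK))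
    (r : R) : IsUnit (truncExp R N (r • x)) :=
  have hn : (r • x) ^ (N + 1) = 0 :=
    DrinfeldKohnoTrunc.pow_eq_zero_of_mem_genSpan (Submodule.smul_mem _ _ hx)
  ⟨⟨truncExp R N (r • x), truncExp R N (-(r • x)), truncExp_mul_truncExp_neg N hn,
    truncExp_neg_mul_truncExp N hn⟩, rfl⟩

/-- `e^{r x}` commutes with whatever `x` commutes with. [folklore] -/
theorem commute_truncExp_smul {x y : DK} (h : Commute x y) (r : R) :
    Commute (truncExp R N (r • x)) y :=
  (Commute.truncExp_right (h.symm.smul_right r) N).symm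

/-! ### Central shifts of group-like three-letter series evaluated at `![x, y, 0]` -/

omit [Algebra ℚ R] in
/-- `![x + z, y, 0] = ![x, y, 0] + ![z, 0, 0]`. [folklore] -/
theorem vec3_add_left {A : Type} [AddMonoid A] (x y z : A) :
    (![x + z, y, 0] : Fin 3 → A) = ![x, y, 0] + ![z, 0, 0] := by
  funext i; fin_cases i <;> simp

omit [Algebra ℚ R] in
/-- `![x, y + z, 0] = ![x, y, 0] + ![0, z, 0]`. [folklore] -/
theorem vec3_add_right {A : Type} [AddMonoid A] (x y z : A) :
    (![x, y + z, 0] : Fin 3 → A) = ![x, y, 0] + ![0, z, 0] := by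
  funext i; fin_cases i <;> simp

omit [Algebra ℚ R] in
/-- The inner sum of `evalTrunc` at a substitution supported on ONE letter `ℓ` collapses to the
power word `ℓⁿ`. [folklore] -/
theorem sum_fin_single_letter {A : Type} [Ring A] [Algebra R A] (S : NCSeries (Fin 3) R)
    (v : Fin 3 → A) (ℓ : Fin 3) (hv : ∀ i, i ≠ ℓ → v i = 0) (n : ℕ) :
    ∑ f : Fin n → Fin 3, S (List.ofFn f) • ((List.ofFn f).map v).prod =
      S (List.replicate n ℓ) • (v ℓ) ^ n := by
  rw [Finset.sum_eq_single_of_mem (fun _ => ℓ) (Finset.mem_univ _) ?_]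
  · simp [List.ofFn_const, List.map_replicate, List.prod_replicate]
  · intro f _ hf
    have : ∃ i, f i ≠ ℓ := by
      by_contra h
      push Not at h
      exact hf (funext h)
    obtain ⟨i, hi⟩ := this
    have h0 : ((List.ofFn f).map v).prod = 0 := by
      apply List.prod_eq_zero
      rw [List.mem_map]
      exact ⟨f i, by simp [List.mem_ofFn], hv _ hi⟩
    rw [h0, smul_zero]

/-- **Left shift evaluates to `1`**: `S(z, 0, 0) = 1` for a group-like `S` with `S(0) = 0`.
[folklore] -/
theorem evalTrunc_vec3_single₀ {S : NCSeries (Fin 3) R} (hS : NCSeries.IsGroupLike S)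
    (h0 : S [0] = 0) (z : DK) : NCSeries.evalTrunc N (![z, 0, 0] : Fin 3 → DK) S = 1 := by
  unfold NCSeries.evalTrunc
  rw [Finset.sum_eq_single_of_mem 0 (by simp) ?_]
  · simp [hS.1]
  · intro n _ hn
    rw [sum_fin_single_letter S _ 0 (fun i hi => by fin_cases i <;> simp_all)]
    rw [hS.apply_replicate_eq_zero h0 n hn, zero_smul]

/-- Coefficients of a group-like series on the powers of a letter: `S(ℓᵏ) = S(ℓ)ᵏ/k!`.
[cite: Reutenauer1993, Thm 3.2] -/
theorem IsGroupLike.apply_replicate {α : Type} [DecidableEq α] {S : NCSeries α R}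
    (hS : NCSeries.IsGroupLike S) (ℓ : α) :
    ∀ k : ℕ, S (List.replicate k ℓ) = algebraMap ℚ R (1 / (k.factorial : ℚ)) * S [ℓ] ^ k
  | 0 => by simp [hS.1]
  | k + 1 => by
    have h := hS.apply_singleton_mul_replicate ℓ k
    rw [IsGroupLike.apply_replicate hS ℓ k] at h
    have hinv : algebraMap ℚ R (1 / (k + 1 : ℚ)) * ((k + 1 : ℕ) : R) = 1 := by
      rw [← map_natCast (algebraMap ℚ R), ← map_mul, ← map_one (algebraMap ℚ R)]
      congr 1; push_cast; field_simp
    have hk : (k.factorial : ℚ) ≠ 0 := by positivity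
    have hq : algebraMap ℚ R (1 / (k + 1 : ℚ)) * algebraMap ℚ R (1 / (k.factorial : ℚ)) =
        algebraMap ℚ R (1 / ((k + 1).factorial : ℚ)) := by
      rw [← map_mul]; congr 1; rw [Nat.factorial_succ]; push_cast; field_simp
    calc S (List.replicate (k + 1) ℓ)
        = algebraMap ℚ R (1 / (k + 1 : ℚ)) * (((k + 1 : ℕ) : R) * S (List.replicate (k + 1) ℓ)) := by
          rw [← mul_assoc, hinv, one_mul]
      _ = algebraMap ℚ R (1 / (k + 1 : ℚ)) *
            (S [ℓ] * (algebraMap ℚ R (1 / (k.factorial : ℚ)) * S [ℓ] ^ k)) := by rw [h]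
      _ = algebraMap ℚ R (1 / ((k + 1).factorial : ℚ)) * S [ℓ] ^ (k + 1) := by
          rw [← hq]; ring

/-- **Right shift evaluates to an exponential**: `S(0, z, 0) = e^{S(1) z}` for a group-like `S`
and weight-one `z`. [cite: Reutenauer1993, Thm 3.2] -/
theorem evalTrunc_vec3_single₁ {S : NCSeries (Fin 3) R} (hS : NCSeries.IsGroupLike S) (z : DK) :
    NCSeries.evalTrunc N (![0, z, 0] : Fin 3 → DK) S = truncExp R N (S [1] • z) := by
  unfold NCSeries.evalTrunc truncExp
  refine Finset.sum_congr rfl fun n _ => ?_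
  rw [sum_fin_single_letter S _ 1 (fun i hi => by fin_cases i <;> simp_all),
    IsGroupLike.apply_replicate hS 1 n, smul_pow, smul_smul]
  simp

/-- **Left central shift** `S(x + z, y, 0) = S(x, y, 0)` for a group-like `S` with `S(0) = 0`,
`z` weight-one commuting with `x, y`. [cite: Furusho2010, Lemma 5 (proof)] -/
theorem evalTrunc_vec3_add_left {S : NCSeries (Fin 3) R} (hS : NCSeries.IsGroupLike S)
    (h0 : S [0] = 0) {x y z : DK} (hx : x ∈ (DrinfeldKohnoTrunc.genSpan : Submodule R DK))
    (hy : y ∈ (DrinfeldKohnoTrunc.genSpan : Submodule R DK))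
    (hz : z ∈ (DrinfeldKohnoTrunc.genSpan : Submodule R DK)) (hzx : Commute z x) (hzy : Commute z y) :
    NCSeries.evalTrunc N (![x + z, y, 0] : Fin 3 → DK) S =
      NCSeries.evalTrunc N (![x, y, 0] : Fin 3 → DK) S := by
  rw [vec3_add_left, hS.evalTrunc_add DrinfeldKohnoTrunc.genSpan
    DrinfeldKohnoTrunc.list_prod_eq_zero_of_mem_genSpan (v₁ := ![x, y, 0]) (v₂ := ![z, 0, 0])
    (fun i => by fin_cases i <;> simp [hx, hy]) (fun i => by fin_cases i <;> simp [hz])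
    (fun i j => by fin_cases i <;> fin_cases j <;> simp [hzx.symm, hzy.symm]),
    evalTrunc_vec3_single₀ hS h0, mul_one]

/-- **Right central shift** `S(x, y + z, 0) = S(x, y, 0) e^{S(1) z}` for a group-like `S`,
`z` weight-one commuting with `x, y`. [cite: Furusho2010, Lemma 5 (proof)] -/
theorem evalTrunc_vec3_add_right {S : NCSeries (Fin 3) R} (hS : NCSeries.IsGroupLike S)
    {x y z : DK} (hx : x ∈ (DrinfeldKohnoTrunc.genSpan : Submodule R DK))
    (hy : y ∈ (DrinfeldKohnoTrunc.genSpan : Submodule R DK))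
    (hz : z ∈ (DrinfeldKohnoTrunc.genSpan : Submodule R DK)) (hzx : Commute z x) (hzy : Commute z y) :
    NCSeries.evalTrunc N (![x, y + z, 0] : Fin 3 → DK) S =
      NCSeries.evalTrunc N (![x, y, 0] : Fin 3 → DK) S * truncExp R N (S [1] • z) := by
  rw [vec3_add_right, hS.evalTrunc_add DrinfeldKohnoTrunc.genSpan
    DrinfeldKohnoTrunc.list_prod_eq_zero_of_mem_genSpan (v₁ := ![x, y, 0]) (v₂ := ![0, z, 0])
    (fun i => by fin_cases i <;> simp [hx, hy]) (fun i => by fin_cases i <;> simp [hz])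
    (fun i j => by fin_cases i <;> fin_cases j <;> simp [hzx.symm, hzy.symm]),
    evalTrunc_vec3_single₁ hS]

/-! ### The two regularisation values used -/

omit [Algebra ℚ R] in
/-- `regEnd₀(0) = 0`: the end-regularised transports have no coefficient on the letter `0`.
[cite: IharaKanekoZagier2006, Cor. 5] -/
theorem regEnd_zero_singleton : Shuffle.regEnd (0 : Fin 3) [0] = 0 := by
  rw [Shuffle.regEnd]
  have : Shuffle.regFront (0 : Fin 3) [0] = 0 := by
    rw [Shuffle.regFront]
    have hl : Shuffle.leadCount (0 : Fin 3) [0] = 1 := by decide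
    rw [hl, Finset.sum_range_succ, Finset.sum_range_succ, Finset.sum_range_zero]
    simp [Shuffle.shuffleSum, Shuffle.wordSum]
  simp [this]

omit [Algebra ℚ R] in
/-- `regEnd₀(1) = 1` (a word not ending in `0` is untouched). [cite: IharaKanekoZagier2006, Cor. 5] -/
theorem regEnd_zero_singleton_one : Shuffle.regEnd (0 : Fin 3) [1] = Finsupp.single [1] 1 := by
  rw [Shuffle.regEnd, Shuffle.regFront]
  have hl : Shuffle.leadCount (0 : Fin 3) [1] = 0 := by decide
  rw [show ([1] : List (Fin 3)).reverse = [1] from rfl, hl, Finset.sum_range_succ, Finset.sum_range_zero]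
  simp [Shuffle.shuffleSum, Shuffle.wordSum]

/-! ### Drinfeld's telescoping, abstract group form -/

/-- **The telescoping lemma** (abstract group form of Drinfeld's argument): in a group, five
"edge" elements given as `Φ₁ = (m₇ e_c)⁻¹ (m₅ e_a)`, …, whose half-transports satisfy the five
corner identities and commute with the five central shifts, satisfy the pentagon
`Φ₅ Φ₄ = Φ₃ Φ₂ Φ₁`. [cite: Drinfeld1991, §2] -/
theorem pentagon_of_corners_group {G : Type} [Group G]
    (m0 m1 m2 m3 m4 m5 m6 m7 m8 m9 m10 m11 m12 m13 m14 ea ec ee eabc ede ecd ecde : G)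
    (c1 : m0 * m5 = m4 * m6) (c2 : m0 * m7 = m1 * m8) (c3 : m2 * m10 = m1 * m9)
    (c4 : m2 * m11 = m3 * m12) (c5 : m4 * m14 = m3 * m13)
    -- exponential identities
    (x1 : ede * ec = ecde) (x2 : ee * ecd = ecde)
    -- commutations
    (k1 : eabc * ec = ec * eabc) (k2 : eabc * m7 = m7 * eabc) (k3 : eabc * m5 = m5 * eabc)
    (k4 : ec * m8 = m8 * ec) (k5 : ec * m9 = m9 * ec) (k6 : ec * ede = ede * ec)
    (k7 : ecde * m10 = m10 * ecde) (k8 : ecde * m11 = m11 * ecde)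
    (k9 : ea * ee = ee * ea) (k10 : ea * m14 = m14 * ea) (k11 : ea * m6 = m6 * ea)
    (k12 : ea * eabc = eabc * ea)
    (k13 : ee * m13 = m13 * ee) (k14 : ee * m12 = m12 * ee) (k15 : ee * ecd = ecd * ee) :
    ((m12 * ecd)⁻¹ * (m13 * ea)) * ((m14 * ee)⁻¹ * (m6 * eabc)) =
      (m11⁻¹ * m10) * (((m9 * ede)⁻¹ * (m8 * eabc)) * ((m7 * ec)⁻¹ * (m5 * ea))) := by
  -- right-hand side
  have hR : (m11⁻¹ * m10) * (((m9 * ede)⁻¹ * (m8 * eabc)) * ((m7 * ec)⁻¹ * (m5 * ea))) =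
      ecde⁻¹ * (m12⁻¹ * (m3⁻¹ * (m4 * (m6 * (eabc * ea))))) := by
    -- corner substitutions as solved equations
    have s2 : m8 * m7⁻¹ = m1⁻¹ * m0 := by
      rw [eq_inv_mul_iff_mul_eq, ← mul_inv_eq_iff_eq_mul.mpr c2.symm]; group
    have s3 : m10 * m9⁻¹ = m2⁻¹ * m1 := by
      rw [eq_inv_mul_iff_mul_eq, ← mul_inv_eq_iff_eq_mul.mpr c3.symm]; group
    have s41 : m11⁻¹ * m2⁻¹ * m0 * m5 = m12⁻¹ * m3⁻¹ * m4 * m6 := by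
      have h1 : m11⁻¹ * m2⁻¹ = (m2 * m11)⁻¹ := by group
      have h2 : m12⁻¹ * m3⁻¹ = (m3 * m12)⁻¹ := by group
      rw [h1, h2, c4, mul_assoc, mul_assoc, c1]
    -- commutations in inverse form
    have k2' : eabc * m7⁻¹ = m7⁻¹ * eabc := by
      rw [eq_comm, inv_mul_eq_iff_eq_mul, ← mul_assoc, ← k2]; group
    have k1' : eabc * ec⁻¹ = ec⁻¹ * eabc := by
      rw [eq_comm, inv_mul_eq_iff_eq_mul, ← mul_assoc, ← k1]; group
    have k5' : ec⁻¹ * m9⁻¹ = m9⁻¹ * ec⁻¹ := by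
      have := congrArg (fun g => g⁻¹) k5; simp only [mul_inv_rev] at this; exact this.symm
    have k4' : ec⁻¹ * m8 = m8 * ec⁻¹ := by
      rw [inv_mul_eq_iff_eq_mul, ← mul_assoc, k4]; group
    have k6' : ede⁻¹ * ec⁻¹ = ec⁻¹ * ede⁻¹ := by
      have := congrArg (fun g => g⁻¹) k6; simp only [mul_inv_rev] at this; exact this
    have k7' : ecde⁻¹ * m10 = m10 * ecde⁻¹ := by
      rw [inv_mul_eq_iff_eq_mul, ← mul_assoc, k7]; group
    have k8' : ecde⁻¹ * m11⁻¹ = m11⁻¹ * ecde⁻¹ := by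
      have := congrArg (fun g => g⁻¹) k8; simp only [mul_inv_rev] at this; exact this.symm
    have hx1 : ede⁻¹ * ec⁻¹ = ecde⁻¹ := by rw [← x1, mul_inv_rev, k6']
    calc (m11⁻¹ * m10) * (((m9 * ede)⁻¹ * (m8 * eabc)) * ((m7 * ec)⁻¹ * (m5 * ea)))
        = m11⁻¹ * m10 * ede⁻¹ * m9⁻¹ * m8 * (eabc * ec⁻¹) * m7⁻¹ * m5 * ea := by group
      _ = m11⁻¹ * m10 * ede⁻¹ * m9⁻¹ * m8 * ec⁻¹ * (eabc * m7⁻¹) * m5 * ea := by rw [k1']; group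
      _ = m11⁻¹ * m10 * ede⁻¹ * m9⁻¹ * m8 * ec⁻¹ * m7⁻¹ * (eabc * m5) * ea := by rw [k2']; group
      _ = m11⁻¹ * m10 * ede⁻¹ * m9⁻¹ * (m8 * ec⁻¹) * m7⁻¹ * m5 * eabc * ea := by rw [k3]; group
      _ = m11⁻¹ * m10 * ede⁻¹ * (m9⁻¹ * ec⁻¹) * m8 * m7⁻¹ * m5 * eabc * ea := by rw [← k4']; group
      _ = m11⁻¹ * m10 * (ede⁻¹ * ec⁻¹) * m9⁻¹ * m8 * m7⁻¹ * m5 * eabc * ea := by rw [← k5']; group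
      _ = m11⁻¹ * (m10 * ecde⁻¹) * m9⁻¹ * m8 * m7⁻¹ * m5 * eabc * ea := by rw [hx1]; group
      _ = (m11⁻¹ * ecde⁻¹) * m10 * m9⁻¹ * m8 * m7⁻¹ * m5 * eabc * ea := by rw [← k7']; group
      _ = ecde⁻¹ * m11⁻¹ * (m10 * m9⁻¹) * (m8 * m7⁻¹) * m5 * eabc * ea := by rw [← k8']; group
      _ = ecde⁻¹ * (m11⁻¹ * m2⁻¹ * m0 * m5) * eabc * ea := by rw [s3, s2]; group
      _ = ecde⁻¹ * (m12⁻¹ * (m3⁻¹ * (m4 * (m6 * (eabc * ea))))) := by rw [s41]; group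
  -- left-hand side
  have hL : ((m12 * ecd)⁻¹ * (m13 * ea)) * ((m14 * ee)⁻¹ * (m6 * eabc)) =
      ecde⁻¹ * (m12⁻¹ * (m3⁻¹ * (m4 * (m6 * (eabc * ea))))) := by
    have s5 : m13 * m14⁻¹ = m3⁻¹ * m4 := by
      rw [eq_inv_mul_iff_mul_eq, ← mul_inv_eq_iff_eq_mul.mpr c5.symm]; group
    have k9' : ea * ee⁻¹ = ee⁻¹ * ea := by
      rw [eq_comm, inv_mul_eq_iff_eq_mul, ← mul_assoc, ← k9]; group
    have k10' : ea * m14⁻¹ = m14⁻¹ * ea := by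
      rw [eq_comm, inv_mul_eq_iff_eq_mul, ← mul_assoc, ← k10]; group
    have k13' : ee⁻¹ * m13 = m13 * ee⁻¹ := by
      rw [inv_mul_eq_iff_eq_mul, ← mul_assoc, k13]; group
    have k14' : ee⁻¹ * m12⁻¹ = m12⁻¹ * ee⁻¹ := by
      have := congrArg (fun g => g⁻¹) k14; simp only [mul_inv_rev] at this; exact this.symm
    have k15' : ecd⁻¹ * ee⁻¹ = ee⁻¹ * ecd⁻¹ := by
      have := congrArg (fun g => g⁻¹) k15; simp only [mul_inv_rev] at this; exact this
    have hx2 : ecd⁻¹ * ee⁻¹ = ecde⁻¹ := by rw [← x2, mul_inv_rev]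
    calc ((m12 * ecd)⁻¹ * (m13 * ea)) * ((m14 * ee)⁻¹ * (m6 * eabc))
        = ecd⁻¹ * m12⁻¹ * m13 * (ea * ee⁻¹) * m14⁻¹ * m6 * eabc := by group
      _ = ecd⁻¹ * m12⁻¹ * m13 * ee⁻¹ * (ea * m14⁻¹) * m6 * eabc := by rw [k9']; group
      _ = ecd⁻¹ * m12⁻¹ * m13 * ee⁻¹ * m14⁻¹ * (ea * m6) * eabc := by rw [k10']; group
      _ = ecd⁻¹ * m12⁻¹ * m13 * ee⁻¹ * m14⁻¹ * m6 * (ea * eabc) := by rw [k11]; group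
      _ = ecd⁻¹ * m12⁻¹ * (m13 * ee⁻¹) * m14⁻¹ * m6 * eabc * ea := by rw [k12]; group
      _ = ecd⁻¹ * (m12⁻¹ * ee⁻¹) * m13 * m14⁻¹ * m6 * eabc * ea := by rw [← k13']; group
      _ = (ecd⁻¹ * ee⁻¹) * m12⁻¹ * (m13 * m14⁻¹) * m6 * eabc * ea := by rw [← k14']; group
      _ = ecde⁻¹ * m12⁻¹ * (m3⁻¹ * m4) * m6 * eabc * ea := by rw [hx2, s5]
      _ = ecde⁻¹ * (m12⁻¹ * (m3⁻¹ * (m4 * (m6 * (eabc * ea))))) := by group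
  rw [hL, hR]

end Algebra

/-! ## 3. The composition: the crux from the stubs -/

set_option maxHeartbeats 800000 in
/-- **The line closes the crux**: the registered stubs (with the landed `stub_pathFamilies`, `stub_groupLike`) imply `PentagonInKZ` (half-edge
factorisations by central shifts and the exponential law, then Drinfeld's telescoping over every
realisation). [cite: Drinfeld1991, §2] -/
theorem PentagonInKZ_of : PentagonInKZ := by
  intro R _ _ χ hrel hmul hunit Z hZ N
  classical
  obtain ⟨I, hI⟩ := stub_pathFamilies
  -- the log-free transports
  set P : Fin 15 → NCSeries (Fin 3) R := fun p W =>
    if W = [] then 1 else Shuffle.pair (fun w => χ (KZ.of (I p w))) (Shuffle.regEnd 0 W) with hPdef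
  have hP : ∀ (p : Fin 15) (W : List (Fin 3)), P p W = if W = [] then 1 else
      Shuffle.pair (fun w => χ (KZ.of (I p w))) (Shuffle.regEnd 0 W) := fun _ _ => rfl
  -- generators
  set a : DrinfeldKohnoTrunc R (Fin 4) N := DrinfeldKohnoTrunc.t R N 0 1 with ha
  set b : DrinfeldKohnoTrunc R (Fin 4) N := DrinfeldKohnoTrunc.t R N 0 2 with hb
  set c : DrinfeldKohnoTrunc R (Fin 4) N := DrinfeldKohnoTrunc.t R N 1 2 with hc
  set d : DrinfeldKohnoTrunc R (Fin 4) N := DrinfeldKohnoTrunc.t R N 1 3 with hd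
  set e : DrinfeldKohnoTrunc R (Fin 4) N := DrinfeldKohnoTrunc.t R N 2 3 with he
  set args : Fin 15 → Fin 3 → DrinfeldKohnoTrunc R (Fin 4) N :=
    ![![a + b + c, e, d], ![c, a, d], ![c + d + e, a + a + b + c, d], ![e, a + b + c, d], ![a, c, d],
      ![a, c, 0], ![a + b + c, e, 0], ![c, a, 0], ![a + b + c, d + e, 0], ![c + d + e, a + b + c, 0],
      ![c, d, 0], ![e, d, 0], ![c + d + e, a, 0], ![a, c + d, 0], ![e, a + b + c, 0]] with hargs
  set M : Fin 15 → DrinfeldKohnoTrunc R (Fin 4) N := fun p => NCSeries.evalTrunc N (args p) (P p)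
    with hMdef
  have hM : ∀ p : Fin 15, M p = NCSeries.evalTrunc N (args p) (P p) := fun _ => rfl
  set φ : NCSeries Bool R := fun W : List Bool => (-1 : R) ^ (W.count true) *
    (MZV.shuffleReg W).sum (fun v a => a • (if MZV.IsConvergentWord v then
      χ (Z (MZV.ofBinaryWord v)) else (0 : R))) with hφ
  set L : R := χ (KZ.of (I 5 [1])) with hL
  set E : DrinfeldKohnoTrunc R (Fin 4) N → DrinfeldKohnoTrunc R (Fin 4) N :=
    fun x => truncExp R N (L • x) with hEdef
  have hE : ∀ x, E x = truncExp R N (L • x) := fun _ => rfl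
  -- the stubs
  obtain ⟨C1, C2, C3, C4, C5⟩ := logfreeCorners R χ hrel hmul hunit I hI P hP N a b c d e
    rfl rfl rfl rfl rfl M hM
  have hSh := stub_shuffleProduct I hI
  have hG : ∀ p : Fin 15, NCSeries.IsGroupLike (P p) := stub_groupLike R χ hrel hmul hunit I hI hSh P hP
  have hU := stub_halfEdgeUniversal R χ hrel hmul hunit Z hZ φ rfl I hI P hP hG N
  have hB := stub_chartB R χ hrel hmul hunit I hI P hP hG N
  -- weight-one memberships
  have ga : a ∈ (DrinfeldKohnoTrunc.genSpan : Submodule R (DrinfeldKohnoTrunc R (Fin 4) N)) :=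
    DrinfeldKohnoTrunc.t_mem_genSpan 0 1
  have gb : b ∈ (DrinfeldKohnoTrunc.genSpan : Submodule R (DrinfeldKohnoTrunc R (Fin 4) N)) :=
    DrinfeldKohnoTrunc.t_mem_genSpan 0 2
  have gc : c ∈ (DrinfeldKohnoTrunc.genSpan : Submodule R (DrinfeldKohnoTrunc R (Fin 4) N)) :=
    DrinfeldKohnoTrunc.t_mem_genSpan 1 2
  have gd : d ∈ (DrinfeldKohnoTrunc.genSpan : Submodule R (DrinfeldKohnoTrunc R (Fin 4) N)) :=
    DrinfeldKohnoTrunc.t_mem_genSpan 1 3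
  have ge : e ∈ (DrinfeldKohnoTrunc.genSpan : Submodule R (DrinfeldKohnoTrunc R (Fin 4) N)) :=
    DrinfeldKohnoTrunc.t_mem_genSpan 2 3
  have g0 : (0 : DrinfeldKohnoTrunc R (Fin 4) N) ∈
      (DrinfeldKohnoTrunc.genSpan : Submodule R (DrinfeldKohnoTrunc R (Fin 4) N)) :=
    Submodule.zero_mem _
  have gargs : ∀ (p : Fin 15) (i : Fin 3), args p i ∈
      (DrinfeldKohnoTrunc.genSpan : Submodule R (DrinfeldKohnoTrunc R (Fin 4) N)) := by
    intro p i
    fin_cases p <;> fin_cases i <;>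
      simp only [hargs] <;>
      first
        | exact g0
        | repeat (first | exact ga | exact gb | exact gc | exact gd | exact ge
                        | refine Submodule.add_mem _ ?_ ?_)
  have gabc : a + b + c ∈ (DrinfeldKohnoTrunc.genSpan : Submodule R (DrinfeldKohnoTrunc R (Fin 4) N)) :=
    Submodule.add_mem _ (Submodule.add_mem _ ga gb) gc
  have gab : a + b ∈ (DrinfeldKohnoTrunc.genSpan : Submodule R (DrinfeldKohnoTrunc R (Fin 4) N)) :=
    Submodule.add_mem _ ga gb
  have gbc : b + c ∈ (DrinfeldKohnoTrunc.genSpan : Submodule R (DrinfeldKohnoTrunc R (Fin 4) N)) :=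
    Submodule.add_mem _ gb gc
  have gde : d + e ∈ (DrinfeldKohnoTrunc.genSpan : Submodule R (DrinfeldKohnoTrunc R (Fin 4) N)) :=
    Submodule.add_mem _ gd ge
  have gcd : c + d ∈ (DrinfeldKohnoTrunc.genSpan : Submodule R (DrinfeldKohnoTrunc R (Fin 4) N)) :=
    Submodule.add_mem _ gc gd
  have gcde : c + d + e ∈ (DrinfeldKohnoTrunc.genSpan : Submodule R (DrinfeldKohnoTrunc R (Fin 4) N)) :=
    Submodule.add_mem _ gcd ge
  -- the infinitesimal braid relations used
  have Fc_ab : Commute c (a + b) := by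
    have h := DrinfeldKohnoTrunc.t_mul_add (R := R) (N := N) (1 : Fin 4) 2 0 (by decide) (by decide)
      (by decide)
    rw [DrinfeldKohnoTrunc.t_symm 1 0, DrinfeldKohnoTrunc.t_symm 2 0] at h
    exact h
  have Fc_de : Commute c (d + e) :=
    DrinfeldKohnoTrunc.t_mul_add (R := R) (N := N) (1 : Fin 4) 2 3 (by decide) (by decide) (by decide)
  have Fa_bc : Commute a (b + c) :=
    DrinfeldKohnoTrunc.t_mul_add (R := R) (N := N) (0 : Fin 4) 1 2 (by decide) (by decide) (by decide)
  have Fa_e : Commute a e :=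
    DrinfeldKohnoTrunc.t_comm (R := R) (N := N) (0 : Fin 4) 1 2 3 (by decide) (by decide) (by decide)
      (by decide) (by decide) (by decide)
  have Fe_cd : Commute e (c + d) := by
    have h := DrinfeldKohnoTrunc.t_mul_add (R := R) (N := N) (2 : Fin 4) 3 1 (by decide) (by decide)
      (by decide)
    rw [DrinfeldKohnoTrunc.t_symm 2 1, DrinfeldKohnoTrunc.t_symm 3 1] at h
    exact h
  have Fd_ce : Commute d (c + e) := by
    have h := DrinfeldKohnoTrunc.t_mul_add (R := R) (N := N) (1 : Fin 4) 3 2 (by decide) (by decide)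
      (by decide)
    rw [DrinfeldKohnoTrunc.t_symm 3 2] at h
    exact h
  -- derived commutations of the five central shifts
  have Zabc_a : Commute (a + b + c) a := by
    rw [add_assoc]; exact ((Commute.refl a).add_left Fa_bc.symm)
  have Zabc_c : Commute (a + b + c) c := Fc_ab.symm.add_left (Commute.refl c)
  have Zc_abc : Commute c (a + b + c) := Zabc_c.symm
  have Zc_de : Commute c (d + e) := Fc_de
  have Zc_cde : Commute c (c + d + e) := by
    rw [add_assoc]; exact (Commute.refl c).add_right Fc_de
  have Zcde_c : Commute (c + d + e) c := Zc_cde.symm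
  have Zcde_d : Commute (c + d + e) d := by
    have : c + d + e = d + (c + e) := by abel
    rw [this]; exact (Commute.refl d).add_left Fd_ce.symm
  have Zcde_e : Commute (c + d + e) e := Fe_cd.symm.add_left (Commute.refl e)
  have Za_e : Commute a e := Fa_e
  have Za_abc : Commute a (a + b + c) := Zabc_a.symm
  have Ze_a : Commute e a := Fa_e.symm
  have Ze_cd : Commute e (c + d) := Fe_cd
  have Ze_cde : Commute e (c + d + e) := Zcde_e.symm
  have Zany_0 : ∀ x : DrinfeldKohnoTrunc R (Fin 4) N, Commute x 0 := fun x => Commute.zero_right x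
  -- exponential identities and commutations
  have KE : ∀ x y : DrinfeldKohnoTrunc R (Fin 4) N, Commute x y → E x * E y = E y * E x :=
    fun x y h => by
      rw [hE, hE]; exact (commute_truncExp_smul (Commute.truncExp_right (h.smul_right L) N) L).eq
  have EE : ∀ x y : DrinfeldKohnoTrunc R (Fin 4) N, Commute x y →
      x ∈ (DrinfeldKohnoTrunc.genSpan : Submodule R (DrinfeldKohnoTrunc R (Fin 4) N)) →
      y ∈ (DrinfeldKohnoTrunc.genSpan : Submodule R (DrinfeldKohnoTrunc R (Fin 4) N)) →
      E x * E y = E (x + y) := fun x y h hx hy => by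
    rw [hE, hE, hE]; exact truncExp_smul_mul_truncExp_smul h hx hy L
  /- ### Part (i): the five half-edge factorisations from the universal stubs -/
  -- identification of paths with the same chart data
  have P_eq_of_chart : ∀ p q : Fin 15,
      (∀ w : List (Fin 3), w.getLast? ≠ some 0 → (I p w).domain = (I q w).domain) →
      (∀ w : List (Fin 3), w.getLast? ≠ some 0 →
        Set.EqOn (I p w).integrand (I q w).integrand (I p w).domain) → P p = P q := by
    intro p q hdom hint
    funext W
    rw [hP, hP]
    split_ifs with hW
    · rfl
    · refine Shuffle.pair_congr fun v hv => ?_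
      have hv0 : v.getLast? ≠ some 0 := Shuffle.getLast?_ne_of_mem_support_regEnd 0 W hv
      have hrel' : KZ.of (I q v) - KZ.of (I p v) ∈ KZ.relations :=
        KZ.of_sub_of_mem_relations_of_eqOn (hdom v hv0)
          (fun t ht => (hint v hv0 (by rw [hdom v hv0]; exact ht)).symm)
      have := hrel _ hrel'
      rw [map_sub, sub_eq_zero] at this
      exact this.symm
  have chartA : ∀ p : Fin 15, p = 6 ∨ p = 7 ∨ p = 8 ∨ p = 9 ∨ p = 12 ∨ p = 13 ∨ p = 14 → P p = P 5 := by
    intro p hp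
    refine P_eq_of_chart p 5 (fun w hw => ?_) (fun w hw => ?_)
    · rw [(hI p w hw).1, (hI 5 w hw).1]
      rcases hp with rfl | rfl | rfl | rfl | rfl | rfl | rfl <;> rfl
    · intro t ht
      have ht5 : t ∈ (I 5 w).domain := by
        rw [(hI 5 w hw).1]; rw [(hI p w hw).1] at ht
        rcases hp with rfl | rfl | rfl | rfl | rfl | rfl | rfl <;> exact ht
      rw [(hI p w hw).2 ht, (hI 5 w hw).2 ht5]
      rcases hp with rfl | rfl | rfl | rfl | rfl | rfl | rfl <;> rfl
  have chartB11 : P 11 = P 10 := by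
    refine P_eq_of_chart 11 10 (fun w hw => ?_) (fun w hw => ?_)
    · rw [(hI 11 w hw).1, (hI 10 w hw).1]; rfl
    · intro t ht
      have ht10 : t ∈ (I 10 w).domain := by
        rw [(hI 10 w hw).1]; rw [(hI 11 w hw).1] at ht; exact ht
      rw [(hI 11 w hw).2 ht, (hI 10 w hw).2 ht10]
      rfl
  -- the two-letter evaluations
  set A : DrinfeldKohnoTrunc R (Fin 4) N → DrinfeldKohnoTrunc R (Fin 4) N → DrinfeldKohnoTrunc R (Fin 4) N :=
    fun x y => NCSeries.evalTrunc N (![x, y, 0] : Fin 3 → DrinfeldKohnoTrunc R (Fin 4) N) (P 5) with hAdef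
  set Bf : DrinfeldKohnoTrunc R (Fin 4) N → DrinfeldKohnoTrunc R (Fin 4) N → DrinfeldKohnoTrunc R (Fin 4) N :=
    fun x w => NCSeries.evalTrunc N (![x, w, 0] : Fin 3 → DrinfeldKohnoTrunc R (Fin 4) N) (P 10) with hBdef
  have m5 : M 5 = A a c := rfl
  have m7 : M 7 = A c a := by rw [hM, chartA 7 (by decide)]; rfl
  have m8 : M 8 = A (a + b + c) (d + e) := by rw [hM, chartA 8 (by decide)]; rfl
  have m9 : M 9 = A (c + d + e) (a + b + c) := by rw [hM, chartA 9 (by decide)]; rfl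
  have m6 : M 6 = A (a + b + c) e := by rw [hM, chartA 6 (by decide)]; rfl
  have m14 : M 14 = A e (a + b + c) := by rw [hM, chartA 14 (by decide)]; rfl
  have m12 : M 12 = A (c + d + e) a := by rw [hM, chartA 12 (by decide)]; rfl
  have m13 : M 13 = A a (c + d) := by rw [hM, chartA 13 (by decide)]; rfl
  have m10 : M 10 = Bf c d := rfl
  have m11 : M 11 = Bf e d := by rw [hM, chartB11]; rfl
  -- coefficients of `P 5` on the letters
  have hP5_0 : P 5 [0] = 0 := by
    rw [hP, if_neg (List.cons_ne_nil _ _), regEnd_zero_singleton, Shuffle.pair_zero]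
  have hP5_1 : P 5 [1] = L := by
    rw [hP, if_neg (List.cons_ne_nil _ _), regEnd_zero_singleton_one, Shuffle.pair_single,
      one_smul]
  -- central shifts for `A`
  have SL : ∀ {x y z : DrinfeldKohnoTrunc R (Fin 4) N},
      x ∈ (DrinfeldKohnoTrunc.genSpan : Submodule R (DrinfeldKohnoTrunc R (Fin 4) N)) →
      y ∈ (DrinfeldKohnoTrunc.genSpan : Submodule R (DrinfeldKohnoTrunc R (Fin 4) N)) →
      z ∈ (DrinfeldKohnoTrunc.genSpan : Submodule R (DrinfeldKohnoTrunc R (Fin 4) N)) →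
      Commute z x → Commute z y → A (x + z) y = A x y :=
    fun hx hy hz hzx hzy => evalTrunc_vec3_add_left (hG 5) hP5_0 hx hy hz hzx hzy
  have SR : ∀ {x y z : DrinfeldKohnoTrunc R (Fin 4) N},
      x ∈ (DrinfeldKohnoTrunc.genSpan : Submodule R (DrinfeldKohnoTrunc R (Fin 4) N)) →
      y ∈ (DrinfeldKohnoTrunc.genSpan : Submodule R (DrinfeldKohnoTrunc R (Fin 4) N)) →
      z ∈ (DrinfeldKohnoTrunc.genSpan : Submodule R (DrinfeldKohnoTrunc R (Fin 4) N)) →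
      Commute z x → Commute z y → A x (y + z) = A x y * E z := by
    intro x y z hx hy hz hzx hzy
    rw [hE, ← hP5_1]
    exact evalTrunc_vec3_add_right (hG 5) hx hy hz hzx hzy
  -- the universal identity, instantiated
  have U : ∀ x y : DrinfeldKohnoTrunc R (Fin 4) N,
      x ∈ (DrinfeldKohnoTrunc.genSpan : Submodule R (DrinfeldKohnoTrunc R (Fin 4) N)) →
      y ∈ (DrinfeldKohnoTrunc.genSpan : Submodule R (DrinfeldKohnoTrunc R (Fin 4) N)) →
      A y x * E y * NCSeries.subst₂ N φ x y = A x y * E x := fun x y hx hy => hU x y hx hy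
  -- commutation of `E z` with `Φ(x,y)` and with `A`-values is only needed through `z` central:
  have KΦ : ∀ {z x y : DrinfeldKohnoTrunc R (Fin 4) N}, Commute z x → Commute z y →
      E z * NCSeries.subst₂ N φ x y = NCSeries.subst₂ N φ x y * E z := fun hzx hzy => by
    rw [hE]
    exact (commute_truncExp_smul (NCSeries.commute_evalTrunc_bsub hzx hzy N φ) L).eq
  have KA : ∀ {z x y : DrinfeldKohnoTrunc R (Fin 4) N}, Commute z x → Commute z y →
      E z * A x y = A x y * E z := fun {z x y} hzx hzy => by
    rw [hE]
    refine (commute_truncExp_smul (commute_evalTrunc (fun i => ?_) N (P 5)) L).eq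
    fin_cases i
    · exact hzx
    · exact hzy
    · exact Commute.zero_right _
  -- H1 (edge 1): directly the universal identity at (a, c)
  have H1 : M 7 * E c * NCSeries.subst₂ N φ a c = M 5 * E a := by
    rw [m7, m5]; exact U a c ga gc
  -- H2 (edge 2): universal identity at (a+b, d+e), shifts by z₂ = c
  have H2 : M 9 * E (d + e) * NCSeries.subst₂ N φ (a + b) (d + e) = M 8 * E (a + b + c) := by
    have h9 : M 9 = A (d + e) (a + b) * E c := by
      rw [m9, show c + d + e = (d + e) + c by abel, SL gde gabc gc Fc_de Zc_abc, SR gde gab gc Fc_de Fc_ab]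
    have h8 : M 8 = A (a + b) (d + e) := by rw [m8, SL gab gde gc Fc_ab Fc_de]
    rw [h9, h8, ← EE (a + b) c Fc_ab.symm gab gc]
    have k1 : E c * E (d + e) = E (d + e) * E c := KE _ _ Fc_de
    have k2 : E c * NCSeries.subst₂ N φ (a + b) (d + e) = NCSeries.subst₂ N φ (a + b) (d + e) * E c :=
      KΦ Fc_ab Fc_de
    calc A (d + e) (a + b) * E c * E (d + e) * NCSeries.subst₂ N φ (a + b) (d + e)
        = A (d + e) (a + b) * E (d + e) * NCSeries.subst₂ N φ (a + b) (d + e) * E c := by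
          rw [mul_assoc (A _ _), k1, ← mul_assoc, mul_assoc _ (E c), k2, ← mul_assoc]
      _ = A (a + b) (d + e) * (E (a + b) * E c) := by rw [U (a + b) (d + e) gab gde, mul_assoc]
  -- H3 (edge 3): chart identity, shifts by -z₃, universal identity at (c, e)
  have H3 : M 11 * NCSeries.subst₂ N φ c e = M 10 := by
    have gz : -(c + d + e) ∈ (DrinfeldKohnoTrunc.genSpan : Submodule R (DrinfeldKohnoTrunc R (Fin 4) N)) :=
      Submodule.neg_mem _ gcde
    have h10 : M 10 = A c e * E (-(c + d + e)) * E c := by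
      rw [m10, hBdef]
      show NCSeries.evalTrunc N ![c, d, 0] (P 10) = _
      rw [hB c d gc gd, show -c - d = e + -(c + d + e) by abel]
      show A c (e + -(c + d + e)) * E c = _
      rw [SR gc ge gz Zcde_c.neg_left Zcde_e.neg_left]
    have h11 : M 11 = A e c * E (-(c + d + e)) * E e := by
      rw [m11, hBdef]
      show NCSeries.evalTrunc N ![e, d, 0] (P 10) = _
      rw [hB e d ge gd, show -e - d = c + -(c + d + e) by abel]
      show A e (c + -(c + d + e)) * E e = _
      rw [SR ge gc gz Zcde_e.neg_left Zcde_c.neg_left]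
    rw [h10, h11]
    have k1 : E (-(c + d + e)) * E e = E e * E (-(c + d + e)) := KE _ _ Zcde_e.neg_left
    have k2 : E (-(c + d + e)) * NCSeries.subst₂ N φ c e = NCSeries.subst₂ N φ c e * E (-(c + d + e)) :=
      KΦ Zcde_c.neg_left Zcde_e.neg_left
    have k3 : E (-(c + d + e)) * E c = E c * E (-(c + d + e)) := KE _ _ Zcde_c.neg_left
    calc A e c * E (-(c + d + e)) * E e * NCSeries.subst₂ N φ c e
        = A e c * E e * NCSeries.subst₂ N φ c e * E (-(c + d + e)) := by
          rw [mul_assoc (A _ _), k1, ← mul_assoc, mul_assoc _ (E (-(c + d + e))), k2, ← mul_assoc]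
      _ = A c e * E c * E (-(c + d + e)) := by rw [U c e gc ge]
      _ = A c e * E (-(c + d + e)) * E c := by rw [mul_assoc, ← k3, ← mul_assoc]
  -- H4 (edge 4): universal identity at (b+c, e), shifts by z₄ = a
  have H4 : M 14 * E e * NCSeries.subst₂ N φ (b + c) e = M 6 * E (a + b + c) := by
    have h14 : M 14 = A e (b + c) * E a := by
      rw [m14, show a + b + c = (b + c) + a by abel, SR ge gbc ga Fa_e Fa_bc]
    have h6 : M 6 = A (b + c) e := by
      rw [m6, show a + b + c = (b + c) + a by abel, SL gbc ge ga Fa_bc Fa_e]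
    rw [h14, h6, show a + b + c = (b + c) + a by abel, ← EE (b + c) a Fa_bc.symm gbc ga]
    have k1 : E a * E e = E e * E a := KE _ _ Fa_e
    have k2 : E a * NCSeries.subst₂ N φ (b + c) e = NCSeries.subst₂ N φ (b + c) e * E a := KΦ Fa_bc Fa_e
    calc A e (b + c) * E a * E e * NCSeries.subst₂ N φ (b + c) e
        = A e (b + c) * E e * NCSeries.subst₂ N φ (b + c) e * E a := by
          rw [mul_assoc (A _ _), k1, ← mul_assoc, mul_assoc _ (E a), k2, ← mul_assoc]
      _ = A (b + c) e * (E (b + c) * E a) := by rw [U (b + c) e gbc ge, mul_assoc]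
  -- H5 (edge 5): universal identity at (a, c+d), left shift by z₅ = e
  have H5 : M 12 * E (c + d) * NCSeries.subst₂ N φ a (c + d) = M 13 * E a := by
    have h12 : M 12 = A (c + d) a := by
      rw [m12, SL gcd ga ge Fe_cd Ze_a]
    rw [h12, m13]; exact U a (c + d) ga gcd
  /- ### Part (ii): Drinfeld's telescoping -/
  -- commutations of exponentials with transports
  have KM : ∀ (x : DrinfeldKohnoTrunc R (Fin 4) N) (p : Fin 15), (∀ i, Commute x (args p i)) →
      E x * M p = M p * E x := fun x p hx => by
    rw [hE, hM]; exact (commute_truncExp_smul (commute_evalTrunc hx N (P p)) L).eq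
  have k1 : E (a + b + c) * E c = E c * E (a + b + c) := KE _ _ Zabc_c
  have k2 : E (a + b + c) * M 7 = M 7 * E (a + b + c) := KM _ 7 (by
    intro i; fin_cases i
    · exact Zabc_c
    · exact Zabc_a
    · exact Zany_0 _)
  have k3 : E (a + b + c) * M 5 = M 5 * E (a + b + c) := KM _ 5 (by
    intro i; fin_cases i
    · exact Zabc_a
    · exact Zabc_c
    · exact Zany_0 _)
  have k4 : E c * M 8 = M 8 * E c := KM _ 8 (by
    intro i; fin_cases i
    · exact Zc_abc
    · exact Zc_de
    · exact Zany_0 _)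
  have k5 : E c * M 9 = M 9 * E c := KM _ 9 (by
    intro i; fin_cases i
    · exact Zc_cde
    · exact Zc_abc
    · exact Zany_0 _)
  have k6 : E c * E (d + e) = E (d + e) * E c := KE _ _ Zc_de
  have k7 : E (c + d + e) * M 10 = M 10 * E (c + d + e) := KM _ 10 (by
    intro i; fin_cases i
    · exact Zcde_c
    · exact Zcde_d
    · exact Zany_0 _)
  have k8 : E (c + d + e) * M 11 = M 11 * E (c + d + e) := KM _ 11 (by
    intro i; fin_cases i
    · exact Zcde_e
    · exact Zcde_d
    · exact Zany_0 _)
  have k9 : E a * E e = E e * E a := KE _ _ Za_e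
  have k10 : E a * M 14 = M 14 * E a := KM _ 14 (by
    intro i; fin_cases i
    · exact Za_e
    · exact Za_abc
    · exact Zany_0 _)
  have k11 : E a * M 6 = M 6 * E a := KM _ 6 (by
    intro i; fin_cases i
    · exact Za_abc
    · exact Za_e
    · exact Zany_0 _)
  have k12 : E a * E (a + b + c) = E (a + b + c) * E a := KE _ _ Za_abc
  have k13 : E e * M 13 = M 13 * E e := KM _ 13 (by
    intro i; fin_cases i
    · exact Ze_a
    · exact Ze_cd
    · exact Zany_0 _)
  have k14 : E e * M 12 = M 12 * E e := KM _ 12 (by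
    intro i; fin_cases i
    · exact Ze_cde
    · exact Ze_a
    · exact Zany_0 _)
  have k15 : E e * E (c + d) = E (c + d) * E e := KE _ _ Ze_cd
  have X1 : E (d + e) * E c = E (c + d + e) := by
    rw [EE _ _ Fc_de.symm gde gc]; congr 1; abel
  have X2 : E e * E (c + d) = E (c + d + e) := by
    rw [EE _ _ Fe_cd ge gcd]; congr 1; abel
  -- units
  have hPnil : ∀ p, P p [] = 1 := fun p => by rw [hP]; simp
  have uM : ∀ p, IsUnit (M p) := fun p => isUnit_evalTrunc_of_mem (gargs p) (hPnil p)
  have uE : ∀ {x : DrinfeldKohnoTrunc R (Fin 4) N},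
      x ∈ (DrinfeldKohnoTrunc.genSpan : Submodule R (DrinfeldKohnoTrunc R (Fin 4) N)) → IsUnit (E x) :=
    fun hx => by rw [hE]; exact isUnit_truncExp_smul hx L
  obtain ⟨m0, hm0⟩ := uM 0; obtain ⟨m1, hm1⟩ := uM 1; obtain ⟨m2, hm2⟩ := uM 2
  obtain ⟨m3, hm3⟩ := uM 3; obtain ⟨m4, hm4⟩ := uM 4; obtain ⟨m5, hm5⟩ := uM 5
  obtain ⟨m6, hm6⟩ := uM 6; obtain ⟨m7, hm7⟩ := uM 7; obtain ⟨m8, hm8⟩ := uM 8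
  obtain ⟨m9, hm9⟩ := uM 9; obtain ⟨m10, hm10⟩ := uM 10; obtain ⟨m11, hm11⟩ := uM 11
  obtain ⟨m12, hm12⟩ := uM 12; obtain ⟨m13, hm13⟩ := uM 13; obtain ⟨m14, hm14⟩ := uM 14
  obtain ⟨ea, hea⟩ := uE ga; obtain ⟨ec, hec⟩ := uE gc; obtain ⟨ee, hee⟩ := uE ge
  obtain ⟨eabc, heabc⟩ := uE gabc; obtain ⟨ede, hede⟩ := uE gde; obtain ⟨ecd, hecd⟩ := uE gcd
  obtain ⟨ecde, hecde⟩ := uE gcde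
  have T : ∀ {u v : (DrinfeldKohnoTrunc R (Fin 4) N)ˣ}, (u : DrinfeldKohnoTrunc R (Fin 4) N) = v → u = v :=
    fun h => Units.ext h
  have key := pentagon_of_corners_group m0 m1 m2 m3 m4 m5 m6 m7 m8 m9 m10 m11 m12 m13 m14
    ea ec ee eabc ede ecd ecde
    (T (by push_cast; rw [hm0, hm5, hm4, hm6]; exact C1))
    (T (by push_cast; rw [hm0, hm7, hm1, hm8]; exact C2))
    (T (by push_cast; rw [hm2, hm10, hm1, hm9]; exact C3))
    (T (by push_cast; rw [hm2, hm11, hm3, hm12]; exact C4))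
    (T (by push_cast; rw [hm4, hm14, hm3, hm13]; exact C5))
    (T (by push_cast; rw [hede, hec, hecde]; exact X1))
    (T (by push_cast; rw [hee, hecd, hecde]; exact X2))
    (T (by push_cast; rw [heabc, hec]; exact k1)) (T (by push_cast; rw [heabc, hm7]; exact k2))
    (T (by push_cast; rw [heabc, hm5]; exact k3)) (T (by push_cast; rw [hec, hm8]; exact k4))
    (T (by push_cast; rw [hec, hm9]; exact k5)) (T (by push_cast; rw [hec, hede]; exact k6))
    (T (by push_cast; rw [hecde, hm10]; exact k7)) (T (by push_cast; rw [hecde, hm11]; exact k8))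
    (T (by push_cast; rw [hea, hee]; exact k9)) (T (by push_cast; rw [hea, hm14]; exact k10))
    (T (by push_cast; rw [hea, hm6]; exact k11)) (T (by push_cast; rw [hea, heabc]; exact k12))
    (T (by push_cast; rw [hee, hm13]; exact k13)) (T (by push_cast; rw [hee, hm12]; exact k14))
    (T (by push_cast; rw [hee, hecd]; exact k15))
  have solve : ∀ {u : (DrinfeldKohnoTrunc R (Fin 4) N)ˣ} {X Y : DrinfeldKohnoTrunc R (Fin 4) N},
      (u : DrinfeldKohnoTrunc R (Fin 4) N) * X = Y → X = (↑u⁻¹ : DrinfeldKohnoTrunc R (Fin 4) N) * Y :=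
    fun {u X Y} h => by rw [← h, Units.inv_mul_cancel_left]
  have e1 : NCSeries.subst₂ N φ a c = ↑((m7 * ec)⁻¹ * (m5 * ea)) := by
    rw [Units.val_mul, Units.val_mul, hm5, hea]
    exact solve (by push_cast; rw [hm7, hec]; exact H1)
  have e2 : NCSeries.subst₂ N φ (a + b) (d + e) = ↑((m9 * ede)⁻¹ * (m8 * eabc)) := by
    rw [Units.val_mul, Units.val_mul, hm8, heabc]
    exact solve (by push_cast; rw [hm9, hede]; exact H2)
  have e3 : NCSeries.subst₂ N φ c e = ↑(m11⁻¹ * m10) := by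
    rw [Units.val_mul, hm10]
    exact solve (by rw [hm11]; exact H3)
  have e4 : NCSeries.subst₂ N φ (b + c) e = ↑((m14 * ee)⁻¹ * (m6 * eabc)) := by
    rw [Units.val_mul, Units.val_mul, hm6, heabc]
    exact solve (by push_cast; rw [hm14, hee]; exact H4)
  have e5 : NCSeries.subst₂ N φ a (c + d) = ↑((m12 * ecd)⁻¹ * (m13 * ea)) := by
    rw [Units.val_mul, Units.val_mul, hm13, hea]
    exact solve (by push_cast; rw [hm12, hecd]; exact H5)
  show NCSeries.subst₂ N φ a (c + d) * NCSeries.subst₂ N φ (b + c) e =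
    NCSeries.subst₂ N φ c e * NCSeries.subst₂ N φ (a + b) (d + e) * NCSeries.subst₂ N φ a c
  rw [e1, e2, e3, e4, e5, ← Units.val_mul, ← Units.val_mul, ← Units.val_mul, key]
  congr 1
  simp only [mul_assoc]

end Summit.KontsevichZagierPeriods.FurushoPentagon.PentagonInKZ
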